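import Literature.Probability.LatticeModels.IsingModel
import Literature.Probability.LatticeModels.ThermodynamicLimit
import Literature.Probability.LatticeModels.ClusterExpansion
import Literature.Combinatorics.Enumerative.ConnectedSetsCoveringWords
import HarnessLib

/-!
# The low-temperature contour representation of the Ising model with `+` boundary condition on
# boxes of `ℤ^d` (Friedli–Velenik 2017, §5.7.4, eqs. (5.39)–(5.46) and Exercise 5.9)

S. Friedli, Y. Velenik, *Statistical Mechanics of Lattice Systems* (CUP 2017), §5.7.4 «Ising model
at low temperature (h = 0)», pp. 256–259 [FriedliVelenik2017]. For the nearest-neighbour Ising model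
in a box `Λ = B(L) ⊂ ℤ^d`, `d ≥ 2`, with `+` boundary condition and zero field, the Hamiltonian is
written as (5.39) `H = -|ℰ_Λ^b| - ∑_{{i,j} ∈ ℰ_Λ^b} (σ_iσ_j - 1)`, so that a configuration `ω`
weighs `e^{β|ℰ_Λ^b|} e^{-2β |∂ω|}` where `∂ω ⊆ ℰ_Λ^b` is its set of disagreement edges (the
plaquettes of `∂ℳ(ω)`, (5.40)–(5.41)); `∂ω` splits into its maximal connected components, the
**contours** `Γ'(ω) = {γ₁,…,γ_n}`, and (Exercise 5.9, for the c-connected volume `Λ = B(L)`) a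
family of contours is `Γ'(ω)` for some `ω` iff its members are pairwise disjoint, whence the
polymer-gas identities (5.42) `Z⁺_{Λ;β,0} = e^{β|ℰ_Λ^b|} Ξ^{LT}_{Λ;β}`,
`Ξ^{LT} = ∑_{admissible Γ'} ∏_{γ ∈ Γ'} e^{-2β|γ|}`, and (5.46)
`⟨σ_A⟩⁺_{Λ;β,0} = Ξ^{LT,A}/Ξ^{LT}` with `w^A(γ) = (-1)^{#{i ∈ A : i ∈ Int γ}} w(γ)`, because
`ω_i = (-1)^{#{γ ∈ Γ'(ω) : i ∈ Int γ}}` (p. 259).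

This file proves these identities, in the following combinatorial dress (all on `ℤ^d`,
`Site d = Fin d → ℤ`, no appeal to the topology of `ℝ^d`):

* an edge of `ℤ^d` is a **key** `(x, k) : Site d × Fin d` standing for `{x, x + e_k}` (`toEdge`,
  a bijection onto the edge set of `zdGraph d`, `edgesTouching_box_eq_image`); the **plaquette**
  `(y; k, l)`, `k ≠ l`, has the four edges `(y,k), (y,l), (y+e_k,l), (y+e_l,k)` (`plaqEdges`); two
  keys are **adjacent** (`Adj`) when they lie on a common plaquette — this replaces «the plaquettes of
  `∂ℳ(ω)` form a connected subset of `ℝ^d`»; any finer notion of connectedness would do as well;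
* a finite edge set `E` is **closed** (`IsClosedKeys E`) when every plaquette contains an even
  number of its edges; the disagreement set `disagree L σ` of a `+`-configuration is closed
  (`isClosedKeys_disagree`);
* the inverse map (the «interior» of p. 259 without Jordan–Brouwer): `rayCount E x` = the number of
  direction-`0` edges of `E` on the ray `x + ℕe₀`, `cfgOf E x = (-1)^{rayCount E x}`; for a closed
  `E ⊆ ℰ^b_{B(L)}` and `d ≥ 2` one has `disagree L (cfgOf E) = E` and `cfgOf E = +1` off `B(L)`
  (`disagree_cfgOf`, `cfgOf_eq_one_of_not_mem_box` — the «strip» and «sideways walk» parity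
  arguments `par_add_par_uvec`, `par_eq_zero_of_not_mem_box`), and conversely `cfgOf (disagree L σ) = σ` (`cfgOf_disagree`): **Exercise 5.9 for
  boxes** as the bijection `{+ configurations on B(L)} ≃ {closed E ⊆ ℰ^b_{B(L)}}`
  (`sum_plusConfig_eq_sum_closed`);
* **contours** (`IsContour`: non-empty, closed, `Adj`-connected), the components `comps E` of a
  closed set (closed, connected, pairwise compatible, partitioning `E`; `comps_biUnion_of_isCompatible`:
  a compatible family of contours is the component family of its union), and the identity
  `∑_{E closed ⊆ ℰ^b} ∏_{γ ∈ comps E} f γ = polymerPartitionFunction inc f (contoursIn L)`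
  (`sum_closedSets_prod_comps`) for the incompatibility
  `inc γ γ' ⇔ γ = γ' ∨ (some edges of γ, γ' share a plaquette)` (`ContourInc`; reflexive, symmetric —
  F–V's «`γ ∩ γ' ≠ ∅` as subsets of `ℝ^d`» (5.43));
* the weights: `Z⁺_{B(L);β,0} = e^{β|ℰ^b|} · Ξ^{LT}` (`isingPartitionFunction_plus_box_eq`, (5.42)) and
  `⟨σ_A⟩⁺_{B(L);β,0} = Ξ^{LT,A}/Ξ^{LT}` (`isingCorr_plus_box_eq_ratio`, (5.46)) with
  `ltWeight β γ = e^{-2β|γ|}`, `ltWeightObs β A γ = σ_A(cfgOf γ) · e^{-2β|γ|}` — the sign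
  `σ_A(cfgOf γ) = (-1)^{#{i ∈ A : i ∈ Int γ}}` being F–V's `w^A_β(γ)/w_β(γ)`, since
  `Int γ = {x : cfgOf γ x = -1}` (`spinProduct_cfgOf_eq_prod_comps`: `σ_A(ω) = ∏_γ σ_A(cfgOf γ)`);
* the move system `keyStep` (alphabet `Fin d × Fin 6`) realising `Adj` (`exists_keyStep_of_adj`),
  so that the tree's contour counting `card_le_pow_of_stepConnected` (F–V Lemma 3.38) applies:
  at most `(6d+1)^{2(n-1)}` contours with `n` edges pass through a given edge
  (`card_le_of_contours_through`); and the contour geometry the cluster-expansion bounds need: a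
  contour surrounding `i` (`(cfgOf γ)_i = -1`) crosses every axis ray from `i`
  (`exists_mem_dir_of_par_ne_zero`), hence has at least `t + 2` edges if it passes at height `t`
  above `i` (`card_ge_of_surround`); connected sets span their coordinate ranges
  (`card_ge_of_isConn`); the union of a cluster of contours is connected
  (`isConn_biUnion_of_isPolymerCluster`).

The cluster-expansion consequences (F–V Exercise 5.10, Thm. 5.16: exponential decay of the truncated
two-point function at large `β`) are in `IsingLowTemperatureTruncatedDecay.lean`. HONEST FRAMING
(cell ym-ir): an Ising-model identity; used for the dual (confined-phase) side of `ℤ₂` lattice gauge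
theory in `d = 3`; nothing here bears on Yang–Mills or the mass gap (Clay).

## References

* S. Friedli, Y. Velenik, *Statistical Mechanics of Lattice Systems*, CUP 2017, §5.7.4,
  eqs. (5.39)–(5.46), Exercise 5.9, Lemma 3.38. [FriedliVelenik2017]
* R. Peierls, Proc. Camb. Phil. Soc. 32 (1936) 477–481 (contours). [Peierls1936]
-/

noncomputable section

open Finset

namespace Literature.Probability.LatticeModels

namespace LTContour

variable {d : ℕ}

/-! ### Keys, unit vectors, plaquettes -/

/-- An edge `{x, x + e_k}` of `ℤ^d`, recorded as the key `(x, k)`. [cite: FriedliVelenik2017, §5.7.4] -/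
abbrev Key (d : ℕ) : Type := Site d × Fin d

/-- The unit coordinate vector `e_k ∈ ℤ^d`. [folklore] -/
def uvec (k : Fin d) : Site d := Pi.single k 1

/-- `(e_k)_k = 1`. [cite: FriedliVelenik2017, §3.1 (ℤ^d: nearest neighbours x, x + e_k; ℰ_Λ^b)] -/
@[simp] theorem uvec_apply_same (k : Fin d) : uvec k k = 1 := by simp [uvec]

/-- `(e_k)_i = 0` for `i ≠ k`. [cite: FriedliVelenik2017, §3.1 (ℤ^d: nearest neighbours x, x + e_k; ℰ_Λ^b)] -/
theorem uvec_apply_of_ne {k i : Fin d} (h : i ≠ k) : uvec k i = 0 := by simp [uvec, h]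

/-- Coordinates of `e_k`. [cite: FriedliVelenik2017, §3.1 (ℤ^d: nearest neighbours x, x + e_k; ℰ_Λ^b)] -/
theorem uvec_apply (k i : Fin d) : uvec k i = if i = k then 1 else 0 := by
  by_cases h : i = k
  · subst h; simp
  · simp [uvec_apply_of_ne h, h]

/-- `k ↦ e_k` is injective. [cite: FriedliVelenik2017, §3.1 (ℤ^d: nearest neighbours x, x + e_k; ℰ_Λ^b)] -/
theorem uvec_injective : Function.Injective (uvec (d := d)) := by
  intro k l h
  by_contra hkl
  have := congrFun h k
  rw [uvec_apply_same, uvec_apply_of_ne hkl] at this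
  exact one_ne_zero this

/-- `e_k ≠ 0`. [cite: FriedliVelenik2017, §3.1 (ℤ^d: nearest neighbours x, x + e_k; ℰ_Λ^b)] -/
theorem uvec_ne_zero (k : Fin d) : uvec k ≠ 0 := by
  intro h; have := congrFun h k; simp at this

/-- The four edges of the plaquette with corner `y` spanned by `e_k, e_l`:
`(y,k), (y,l), (y+e_k,l), (y+e_l,k)`. [cite: FriedliVelenik2017, §5.7.4 (plaquettes)] -/
def plaqEdges (y : Site d) (k l : Fin d) : Finset (Key d) :=
  {(y, k), (y, l), (y + uvec k, l), (y + uvec l, k)}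

/-- The four edges of a plaquette, as a disjunction. [cite: FriedliVelenik2017, §5.7.4 (contours: plaquettes of ∂ℳ(ω), pp. 256–257)] -/
theorem mem_plaqEdges {y : Site d} {k l : Fin d} {e : Key d} :
    e ∈ plaqEdges y k l ↔ e = (y, k) ∨ e = (y, l) ∨ e = (y + uvec k, l) ∨ e = (y + uvec l, k) := by
  simp [plaqEdges]

/-- `(y; k, l)` and `(y; l, k)` are the same plaquette. [cite: FriedliVelenik2017, §5.7.4 (contours: plaquettes of ∂ℳ(ω), pp. 256–257)] -/
theorem plaqEdges_comm (y : Site d) (k l : Fin d) : plaqEdges y k l = plaqEdges y l k := by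
  ext e; simp only [mem_plaqEdges]; tauto

/-- Two keys are adjacent when they lie on a common plaquette. [cite: FriedliVelenik2017, §5.7.4 (connected components of ∂ℳ(ω))] -/
def Adj (e e' : Key d) : Prop := ∃ (y : Site d) (k l : Fin d), k ≠ l ∧ e ∈ plaqEdges y k l ∧ e' ∈ plaqEdges y k l

/-- Adjacency is symmetric. [cite: FriedliVelenik2017, §5.7.4 (contours: plaquettes of ∂ℳ(ω), pp. 256–257)] -/
theorem Adj.symm {e e' : Key d} (h : Adj e e') : Adj e' e := by
  obtain ⟨y, k, l, hkl, h1, h2⟩ := h; exact ⟨y, k, l, hkl, h2, h1⟩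

/-- Adjacency is symmetric (iff form). [cite: FriedliVelenik2017, §5.7.4 (contours: plaquettes of ∂ℳ(ω), pp. 256–257)] -/
theorem adj_comm {e e' : Key d} : Adj e e' ↔ Adj e' e := ⟨Adj.symm, Adj.symm⟩

/-- In `d ≥ 2` every key lies on a plaquette, so `Adj` is reflexive. [cite: FriedliVelenik2017, §5.7.4 (contours: plaquettes of ∂ℳ(ω), pp. 256–257)] -/
theorem Adj.refl (hd : 2 ≤ d) (e : Key d) : Adj e e := by
  obtain ⟨x, k⟩ := e
  obtain ⟨l, hl⟩ : ∃ l : Fin d, l ≠ k := by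
    by_cases hk : (k : ℕ) = 0
    · exact ⟨⟨1, by omega⟩, fun h => by simp [Fin.ext_iff, hk] at h⟩
    · exact ⟨⟨0, by omega⟩, fun h => by simp [Fin.ext_iff] at h; omega⟩
  exact ⟨x, k, l, hl.symm, by simp [mem_plaqEdges], by simp [mem_plaqEdges]⟩

/-! ### Indicators in `ZMod 2` and closed edge sets -/

/-- The indicator of `E` at a key, in `ZMod 2`. [folklore] -/
def ind (E : Finset (Key d)) (e : Key d) : ZMod 2 := if e ∈ E then 1 else 0

/-- Indicator of a member. [cite: FriedliVelenik2017, §5.7.4 (contours: plaquettes of ∂ℳ(ω), pp. 256–257)] -/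
theorem ind_of_mem {E : Finset (Key d)} {e : Key d} (h : e ∈ E) : ind E e = 1 := by simp [ind, h]

/-- Indicator of a non-member. [cite: FriedliVelenik2017, §5.7.4 (contours: plaquettes of ∂ℳ(ω), pp. 256–257)] -/
theorem ind_of_not_mem {E : Finset (Key d)} {e : Key d} (h : e ∉ E) : ind E e = 0 := by simp [ind, h]

/-- The plaquette parity of `E` at `(y; k, l)`. [cite: FriedliVelenik2017, §5.7.4] -/
def plaqParity (E : Finset (Key d)) (y : Site d) (k l : Fin d) : ZMod 2 :=
  ind E (y, k) + ind E (y, l) + ind E (y + uvec k, l) + ind E (y + uvec l, k)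

/-- A finite edge set is **closed** when every plaquette contains an even number of its edges
(the plaquette sets `∂ℳ(ω)` and their components are of this kind). [cite: FriedliVelenik2017, §5.7.4 (the boundary ∂ℳ(ω))] -/
def IsClosedKeys (E : Finset (Key d)) : Prop := ∀ (y : Site d) (k l : Fin d), k ≠ l → plaqParity E y k l = 0

/-- `2 = 0` in `ZMod 2`. [folklore] -/
private theorem ZMod.two_eq_zero' : (2 : ZMod 2) = 0 := by decide

/-- `a + a = 0` in `ZMod 2`. [folklore] -/
private theorem zmod2_add_self (a : ZMod 2) : a + a = 0 := by
  rw [← two_mul, ZMod.two_eq_zero', zero_mul]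

/-- `ZMod 2 = {0, 1}`. [folklore] -/
private theorem zmod2_eq_zero_or_one : ∀ a : ZMod 2, a = 0 ∨ a = 1 := by decide

/-- Indicator of the empty set. [folklore] -/
private theorem ind_empty (e : Key d) : ind (∅ : Finset (Key d)) e = 0 := by simp [ind]

/-! ### The sign of a spin in `ZMod 2` -/

/-- `sgn σ x = 0` if `σ_x = +1` and `= 1` if `σ_x = -1`. [folklore] -/
def sgn (σ : SpinConfig (Site d)) (x : Site d) : ZMod 2 := if σ x = 1 then 0 else 1

/-- `ℤˣ = {1, -1}`. [folklore] -/
private theorem units_int_eq_one_or (u : ℤˣ) : u = 1 ∨ u = -1 := Int.units_eq_one_or u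

/-- `sgn = 0 ⇔ σ_x = 1`. [folklore] -/
private theorem sgn_eq_zero_iff {σ : SpinConfig (Site d)} {x : Site d} : sgn σ x = 0 ↔ σ x = 1 := by
  unfold sgn; split_ifs with h <;> simp [h]

/-- `sgn = 1 ⇔ σ_x = -1`. [folklore] -/
private theorem sgn_eq_one_iff {σ : SpinConfig (Site d)} {x : Site d} : sgn σ x = 1 ↔ σ x = -1 := by
  unfold sgn
  split_ifs with h
  · simp only [zero_ne_one, false_iff]; rw [h]; decide
  · simp only [true_iff]; exact (units_int_eq_one_or (σ x)).resolve_left h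

/-- Two spins disagree iff their signs add up to `1`. [folklore] -/
private theorem sgn_add_sgn_eq_one_iff {σ : SpinConfig (Site d)} {x y : Site d} :
    sgn σ x + sgn σ y = 1 ↔ σ x ≠ σ y := by
  rcases units_int_eq_one_or (σ x) with hx | hx <;> rcases units_int_eq_one_or (σ y) with hy | hy <;>
    simp [sgn, hx, hy]

/-- Sum of two signs as a disagreement indicator. [folklore] -/
private theorem sgn_add_sgn_eq {σ : SpinConfig (Site d)} {x y : Site d} :
    sgn σ x + sgn σ y = if σ x ≠ σ y then 1 else 0 := by
  split_ifs with h
  · exact sgn_add_sgn_eq_one_iff.2 h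
  · push Not at h
    rw [show sgn σ y = sgn σ x by simp [sgn, h], zmod2_add_self]

/-! ### Boxes, their edges and disagreement sets -/

/-- The keys of the edges `ℰ^b_{B(L)}` touching the box `B(L)`: `(x,k)` with `x ∈ B(L)` or
`x + e_k ∈ B(L)`. [cite: FriedliVelenik2017, §3.1 (ℰ_Λ^b) and §5.7.4] -/
def boxKeys (L : ℕ) : Finset (Key d) :=
  ((box d (L + 1)) ×ˢ (univ : Finset (Fin d))).filter fun e => e.1 ∈ box d L ∨ e.1 + uvec e.2 ∈ box d L

/-- `x + e_k ∈ B(L) ⇒ x ∈ B(L+1)`. [folklore] -/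
private theorem mem_box_succ_of_add_uvec_mem {L : ℕ} {x : Site d} {k : Fin d} (h : x + uvec k ∈ box d L) :
    x ∈ box d (L + 1) := by
  rw [mem_box] at h ⊢
  intro i
  have := h i
  simp only [Pi.add_apply, uvec_apply] at this
  push_cast
  split_ifs at this <;> constructor <;> omega

/-- Membership in `ℰ^b_{B(L)}`: an endpoint in the box. [cite: FriedliVelenik2017, §3.1 (ℤ^d: nearest neighbours x, x + e_k; ℰ_Λ^b)] -/
theorem mem_boxKeys {L : ℕ} {e : Key d} : e ∈ boxKeys L ↔ e.1 ∈ box d L ∨ e.1 + uvec e.2 ∈ box d L := by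
  simp only [boxKeys, mem_filter, mem_product, mem_univ, and_true, and_iff_right_iff_imp]
  rintro (h | h)
  · exact box_mono d (Nat.le_succ L) h
  · exact mem_box_succ_of_add_uvec_mem h

/-- The disagreement set `∂ω ⊆ ℰ^b_{B(L)}` of a configuration: the box edges whose endpoints carry
opposite spins (the plaquettes of `∂ℳ(ω)`, (5.40)). [cite: FriedliVelenik2017, §5.7.4 eq. (5.40)] -/
def disagree (L : ℕ) (σ : SpinConfig (Site d)) : Finset (Key d) :=
  (boxKeys L).filter fun e => σ e.1 ≠ σ (e.1 + uvec e.2)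

/-- Membership in the disagreement set `∂σ`. [cite: FriedliVelenik2017, §5.7.4 eq. (5.40)] -/
theorem mem_disagree {L : ℕ} {σ : SpinConfig (Site d)} {e : Key d} :
    e ∈ disagree L σ ↔ e ∈ boxKeys L ∧ σ e.1 ≠ σ (e.1 + uvec e.2) := by
  simp [disagree]

/-- `∂σ ⊆ ℰ^b_{B(L)}`. [cite: FriedliVelenik2017, §5.7.4 eq. (5.40)] -/
theorem disagree_subset (L : ℕ) (σ : SpinConfig (Site d)) : disagree L σ ⊆ boxKeys L := filter_subset _ _

/-- A configuration is a `+`-configuration of the box `B(L)` when it equals `+1` off `B(L)`.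
[cite: FriedliVelenik2017, §3.1 (Ω_Λ^+)] -/
def IsPlusCfg (L : ℕ) (σ : SpinConfig (Site d)) : Prop := ∀ x, x ∉ box d L → σ x = 1

/-- Glued configurations with `+` boundary condition are `+`-configurations. [cite: FriedliVelenik2017, §3.1 (Ω_Λ^+)] -/
theorem isPlusCfg_glue (L : ℕ) (τ : ↥(box d L) → ℤˣ) : IsPlusCfg L (glue (box d L) τ .plus) := by
  intro x hx
  rw [glue_apply_of_notMem _ _ _ hx]
  rfl

/-- For a `+`-configuration, the indicator of the disagreement set at ANY key is the sum of the signs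
of its endpoints. [cite: FriedliVelenik2017, §5.7.4] -/
theorem ind_disagree {L : ℕ} {σ : SpinConfig (Site d)} (hσ : IsPlusCfg L σ) (e : Key d) :
    ind (disagree L σ) e = sgn σ e.1 + sgn σ (e.1 + uvec e.2) := by
  rw [sgn_add_sgn_eq]
  by_cases he : e ∈ boxKeys L
  · simp only [ind, mem_disagree, he, true_and]
  · have h1 : σ e.1 = 1 := hσ _ fun h => he (mem_boxKeys.2 (Or.inl h))
    have h2 : σ (e.1 + uvec e.2) = 1 := hσ _ fun h => he (mem_boxKeys.2 (Or.inr h))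
    rw [ind_of_not_mem fun h => he (disagree_subset L σ h)]
    simp [h1, h2]

/-- **The disagreement set of a `+`-configuration is closed.** [cite: FriedliVelenik2017, §5.7.4 (∂ℳ(ω) is a union of closed contours)] -/
theorem isClosedKeys_disagree {L : ℕ} {σ : SpinConfig (Site d)} (hσ : IsPlusCfg L σ) :
    IsClosedKeys (disagree L σ) := by
  intro y k l _
  simp only [plaqParity, ind_disagree hσ]
  rw [show y + uvec k + uvec l = y + uvec l + uvec k by abel]
  -- every sign appears twice
  have : ∀ a b c e : ZMod 2, a + b + (a + c) + (b + e) + (c + e) = 0 := by decide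
  exact this _ _ _ _

/-- Coordinates of `x + e_k`. [cite: FriedliVelenik2017, §3.1 (ℤ^d: nearest neighbours x, x + e_k; ℰ_Λ^b)] -/
theorem add_uvec_apply (x : Site d) (k i : Fin d) : (x + uvec k) i = x i + if i = k then 1 else 0 := by
  simp [uvec_apply]

/-- Coordinates of `x + n e_k`. [cite: FriedliVelenik2017, §3.1 (ℤ^d: nearest neighbours x, x + e_k; ℰ_Λ^b)] -/
theorem add_nsmul_uvec_apply (x : Site d) (k : Fin d) (n : ℕ) (i : Fin d) :
    (x + n • uvec k) i = x i + if i = k then (n : ℤ) else 0 := by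
  simp only [Pi.add_apply, Pi.smul_apply, uvec_apply]
  split_ifs <;> simp

/-- Coordinates of `x - n e_k`. [cite: FriedliVelenik2017, §3.1 (ℤ^d: nearest neighbours x, x + e_k; ℰ_Λ^b)] -/
theorem sub_nsmul_uvec_apply (x : Site d) (k : Fin d) (n : ℕ) (i : Fin d) :
    (x - n • uvec k) i = x i - if i = k then (n : ℤ) else 0 := by
  simp only [Pi.sub_apply, Pi.smul_apply, uvec_apply]
  split_ifs <;> simp

/-- The closed subsets of `ℰ^b_{B(L)}` — the admissible contour configurations. [cite: FriedliVelenik2017, Exercise 5.9] -/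
def closedSets (L : ℕ) : Finset (Finset (Key d)) :=
  open Classical in (boxKeys (d := d) L).powerset.filter IsClosedKeys

/-- Membership in `closedSets L`. [cite: FriedliVelenik2017, Exercise 5.9] -/
theorem mem_closedSets {L : ℕ} {E : Finset (Key d)} : E ∈ closedSets L ↔ E ⊆ boxKeys L ∧ IsClosedKeys E := by
  classical
  simp [closedSets]

/-! ### Rays in direction `e₀`, the parity configuration `cfgOf E` -/

section Ray

variable [NeZero d]

/-- `y` lies on the closed ray `x + ℕ e₀` (the rays replace F–V's interiors: `i ∈ Int γ` iff the ray from `i` crosses `γ` an odd number of times). [cite: FriedliVelenik2017, §5.7.4 (Int γ and ω_i = (-1)^#, p. 259)] -/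
def OnRay (x y : Site d) : Prop := x 0 ≤ y 0 ∧ ∀ i, i ≠ 0 → y i = x i

/-- `OnRay` is decidable (finitely many coordinates). [folklore] -/
instance (x y : Site d) : Decidable (OnRay x y) := inferInstanceAs (Decidable (_ ∧ _))

/-- A point is on its own ray. [folklore] -/
private theorem onRay_refl (x : Site d) : OnRay x x := ⟨le_rfl, fun _ _ => rfl⟩

/-- The ray from `x` is `x` followed by the ray from `x + e₀`. [folklore] -/
private theorem onRay_iff (x y : Site d) : OnRay x y ↔ y = x ∨ OnRay (x + uvec 0) y := by
  constructor
  · rintro ⟨h0, hi⟩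
    by_cases h : y 0 = x 0
    · left; funext i; by_cases hi0 : i = 0
      · subst hi0; exact h
      · exact hi i hi0
    · right
      refine ⟨?_, fun i hi0 => ?_⟩
      · rw [add_uvec_apply, if_pos rfl]; omega
      · rw [add_uvec_apply, if_neg hi0, add_zero]; exact hi i hi0
  · rintro (h | ⟨h0, hi⟩)
    · rw [h]; exact onRay_refl x
    · refine ⟨?_, fun i hi0 => ?_⟩
      · rw [add_uvec_apply, if_pos rfl] at h0; omega
      · rw [hi i hi0, add_uvec_apply, if_neg hi0, add_zero]

/-- `x` is not on the ray from `x + e₀`. [folklore] -/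
private theorem not_onRay_add_uvec_self (x : Site d) : ¬ OnRay (x + uvec 0) x := by
  rintro ⟨h0, -⟩; rw [add_uvec_apply, if_pos rfl] at h0; omega

/-- The direction-`0` edges of `E` on the ray `x + ℕe₀`. [cite: FriedliVelenik2017, §5.7.4 (Int γ, p. 259)] -/
def rayKeys (E : Finset (Key d)) (x : Site d) : Finset (Key d) := E.filter fun e => e.2 = 0 ∧ OnRay x e.1

/-- `rayCount E x = #{t ∈ ℕ : (x + t e₀, 0) ∈ E}`, the number of edges of `E` crossed by the ray from
`x` in direction `e₀`. [cite: FriedliVelenik2017, §5.7.4 (ω_i = (-1)^{#{γ : i ∈ Int γ}}, p. 259)] -/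
def rayCount (E : Finset (Key d)) (x : Site d) : ℕ := (rayKeys E x).card

/-- The ray parity `rayCount E x mod 2`. [cite: FriedliVelenik2017, §5.7.4 p. 259] -/
def par (E : Finset (Key d)) (x : Site d) : ZMod 2 := (rayCount E x : ZMod 2)

/-- The configuration with contour set `E`: `(cfgOf E)_x = (-1)^{rayCount E x}` (for a single contour
`γ`, `{x : (cfgOf γ)_x = -1}` is F–V's `Int γ`). [cite: FriedliVelenik2017, §5.7.4 (ω^γ and Int γ, p. 259)] -/
def cfgOf (E : Finset (Key d)) : SpinConfig (Site d) := fun x => if par E x = 0 then 1 else -1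

/-- The sign of the parity configuration is the parity. [folklore] -/
private theorem sgn_cfgOf (E : Finset (Key d)) (x : Site d) : sgn (cfgOf E) x = par E x := by
  unfold sgn cfgOf
  rcases zmod2_eq_zero_or_one (par E x) with h | h <;> simp [h]

/-- `(cfgOf E)_x = +1` iff the ray parity at `x` vanishes (`x ∉ Int`). [cite: FriedliVelenik2017, §5.7.4 (Int γ and ω_i = (-1)^#, p. 259)] -/
theorem cfgOf_eq_one_iff {E : Finset (Key d)} {x : Site d} : cfgOf E x = 1 ↔ par E x = 0 := by
  rw [← sgn_eq_zero_iff, sgn_cfgOf]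

/-- One step up the ray. [folklore] -/
private theorem rayKeys_eq (E : Finset (Key d)) (x : Site d) :
    rayKeys E x = (if (x, (0 : Fin d)) ∈ E then {(x, (0 : Fin d))} else ∅) ∪ rayKeys E (x + uvec 0) := by
  ext e
  simp only [rayKeys, mem_filter, mem_union]
  rw [onRay_iff]
  constructor
  · rintro ⟨he, h2, h1 | hr⟩
    · left
      have : e = (x, (0 : Fin d)) := Prod.ext h1 h2
      subst this
      simp [he]
    · right; exact ⟨he, h2, hr⟩
  · rintro (h | ⟨he, h2, hr⟩)
    · split_ifs at h with hx
      · simp only [mem_singleton] at h; subst h; exact ⟨hx, rfl, Or.inl rfl⟩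
      · simp at h
    · exact ⟨he, h2, Or.inr hr⟩

/-- **One step up the ray**: `par E x = 𝟙[(x,0) ∈ E] + par E (x + e₀)`. [cite: FriedliVelenik2017, §5.7.4 (Int γ and ω_i = (-1)^#, p. 259)] -/
theorem par_eq (E : Finset (Key d)) (x : Site d) : par E x = ind E (x, 0) + par E (x + uvec 0) := by
  unfold par rayCount
  rw [rayKeys_eq, card_union_of_disjoint]
  · push_cast
    unfold ind
    split_ifs <;> simp
  · split_ifs with hx
    · rw [disjoint_singleton_left]
      simp only [rayKeys, mem_filter, not_and]
      exact fun _ _ => not_onRay_add_uvec_self x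
    · exact disjoint_empty_left _

/-- Parities at the ends of a vertical edge. [folklore] -/
private theorem par_add_par_uvec_zero (E : Finset (Key d)) (x : Site d) :
    par E x + par E (x + uvec 0) = ind E (x, 0) := by
  rw [par_eq E x, add_assoc, zmod2_add_self, add_zero]

/-- No edge of `E` on the ray: the ray count vanishes. [folklore] -/
private theorem rayCount_eq_zero {E : Finset (Key d)} {x : Site d} (h : ∀ e ∈ E, e.2 = 0 → ¬ OnRay x e.1) :
    rayCount E x = 0 := by
  unfold rayCount rayKeys
  rw [card_eq_zero, filter_eq_empty_iff]
  exact fun e he ⟨h2, hr⟩ => h e he h2 hr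

/-- No edge of `E` on the ray: the parity vanishes. [folklore] -/
private theorem par_eq_zero {E : Finset (Key d)} {x : Site d} (h : ∀ e ∈ E, e.2 = 0 → ¬ OnRay x e.1) :
    par E x = 0 := by
  unfold par; rw [rayCount_eq_zero h, Nat.cast_zero]

/-- A point strictly above all of `E` has parity zero. [folklore] -/
private theorem par_eq_zero_of_above {E : Finset (Key d)} {x : Site d} (h : ∀ e ∈ E, e.1 0 < x 0) : par E x = 0 :=
  par_eq_zero fun e he _ hr => by have := h e he; have := hr.1; omega

/-- No key of `E` is based strictly above all of `E`. [folklore] -/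
private theorem ind_eq_zero_of_above {E : Finset (Key d)} {x : Site d} (h : ∀ e ∈ E, e.1 0 < x 0) (k : Fin d) :
    ind E (x, k) = 0 :=
  ind_of_not_mem fun he => lt_irrefl _ (h _ he)

/-- Some height on the ray from `y` is above all of `E`. [folklore] -/
private theorem exists_above (E : Finset (Key d)) (y : Site d) : ∃ T : ℕ, ∀ e ∈ E, e.1 0 < y 0 + T := by
  obtain ⟨B, hB⟩ := Finset.bddAbove (E.image fun e : Key d => e.1 0)
  refine ⟨(B - y 0 + 1).toNat, fun e he => ?_⟩
  have h1 : e.1 0 ≤ B := hB (mem_image_of_mem _ he)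
  have h2 := Int.self_le_toNat (B - y 0 + 1)
  omega

/-- **The strip identity.** For a closed `E` and a direction `i ≠ 0`, the parities at the two ends of
the edge `(y, i)` differ exactly when `(y, i) ∈ E`: sum the plaquette parities of the column of
`(e₀, e_i)`-plaquettes above the edge. [cite: FriedliVelenik2017, §5.7.4 (Exercise 5.9)] -/
theorem par_add_par_uvec {E : Finset (Key d)} (hE : IsClosedKeys E) {i : Fin d} (hi : i ≠ 0) (y : Site d) :
    par E y + par E (y + uvec i) = ind E (y, i) := by
  -- climbing one plaquette at a time
  have step : ∀ T : ℕ, ind E (y, i) + par E y + par E (y + uvec i) =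
      ind E (y + T • uvec 0, i) + par E (y + T • uvec 0) + par E (y + T • uvec 0 + uvec i) := by
    intro T
    induction T with
    | zero => simp
    | succ T ih =>
      set z := y + T • uvec 0 with hz
      have hplaq := hE z 0 i hi.symm
      simp only [plaqParity] at hplaq
      have h1 := par_eq E z
      have h2 := par_eq E (z + uvec i)
      have e1 : y + (T + 1) • uvec 0 = z + uvec 0 := by rw [hz, succ_nsmul, add_assoc]
      have e2 : z + uvec i + uvec 0 = z + uvec 0 + uvec i := by abel
      rw [ih, e1, h1, ← e2, h2]
      have key : ∀ a b c e p q : ZMod 2, a + b + c + e = 0 → b + (a + p) + (e + q) = c + p + q := by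
        decide
      exact key _ _ _ _ _ _ hplaq
  obtain ⟨T, hT⟩ := exists_above E y
  have htop : ∀ e ∈ E, e.1 0 < (y + T • uvec 0 : Site d) 0 := fun e he => by
    rw [add_nsmul_uvec_apply, if_pos rfl]; exact hT e he
  have htop' : ∀ e ∈ E, e.1 0 < (y + T • uvec 0 + uvec i : Site d) 0 := fun e he => by
    rw [add_uvec_apply, if_neg hi.symm, add_zero]; exact htop e he
  have := step T
  rw [ind_eq_zero_of_above htop, par_eq_zero_of_above htop, par_eq_zero_of_above htop'] at this
  simp only [add_zero] at this
  -- `a + b + c = 0 ⇒ b + c = a` in `ZMod 2`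
  have key : ∀ a b c : ZMod 2, a + b + c = 0 → b + c = a := by decide
  exact key _ _ _ this

/-- For closed `E`: the parities at the endpoints of any key `e` differ iff `e ∈ E`. [cite: FriedliVelenik2017, §5.7.4 (Exercise 5.9)] -/
theorem par_add_par_tip {E : Finset (Key d)} (hE : IsClosedKeys E) (e : Key d) :
    par E e.1 + par E (e.1 + uvec e.2) = ind E e := by
  obtain ⟨x, k⟩ := e
  by_cases hk : k = 0
  · subst hk; exact par_add_par_uvec_zero E x
  · exact par_add_par_uvec hE hk x

/-- Off to the side or above the box, the ray from `x` meets no edge of `ℰ^b_{B(L)}`. [cite: FriedliVelenik2017, Exercise 5.9] -/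
theorem par_eq_zero_of_miss {E : Finset (Key d)} {L : ℕ} (hEL : E ⊆ boxKeys L) {x : Site d}
    (hx : (∃ i, i ≠ 0 ∧ (x i < -(L : ℤ) ∨ (L : ℤ) < x i)) ∨ (L : ℤ) < x 0) : par E x = 0 := by
  refine par_eq_zero fun e he h2 hr => ?_
  have hb := mem_boxKeys.1 (hEL he)
  rw [h2] at hb
  obtain ⟨h0, hrest⟩ := hr
  rcases hx with ⟨i, hi, hout⟩ | htop
  · have hei : e.1 i = x i := hrest i hi
    rcases hb with hb | hb
    · have := (mem_box.1 hb) i; omega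
    · have := (mem_box.1 hb) i
      rw [add_uvec_apply, if_neg hi] at this; omega
  · rcases hb with hb | hb
    · have := (mem_box.1 hb) 0; omega
    · have := (mem_box.1 hb) 0
      rw [add_uvec_apply, if_pos rfl] at this; omega

/-- **A closed edge set inside `ℰ^b_{B(L)}` encloses no point outside the box** (`d ≥ 2`): the parity
configuration is `+1` off `B(L)`. Below the box one walks sideways in direction `e₁` (no edge of
`ℰ^b` is met) until the ray misses the box. [cite: FriedliVelenik2017, Exercise 5.9 (c-connectedness of the box)] -/
theorem par_eq_zero_of_not_mem_box (hd : 2 ≤ d) {E : Finset (Key d)} (hE : IsClosedKeys E) {L : ℕ}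
    (hEL : E ⊆ boxKeys L) {x : Site d} (hx : x ∉ box d L) : par E x = 0 := by
  rw [mem_box, not_forall] at hx
  obtain ⟨i, hi⟩ := hx
  rw [not_and_or, not_le, not_le] at hi
  by_cases hi0 : i ≠ 0
  · exact par_eq_zero_of_miss hEL (Or.inl ⟨i, hi0, hi⟩)
  push Not at hi0; subst hi0
  rcases hi with hlow | hhigh
  swap
  · exact par_eq_zero_of_miss hEL (Or.inr hhigh)
  -- below the box: sideways walk in direction `j = 1`
  by_cases hside : ∃ i, i ≠ 0 ∧ (x i < -(L : ℤ) ∨ (L : ℤ) < x i)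
  · exact par_eq_zero_of_miss hEL (Or.inl hside)
  push Not at hside
  set j : Fin d := ⟨1, by omega⟩ with hj
  have hj0 : j ≠ 0 := fun h => by simp [hj, Fin.ext_iff] at h
  have walk : ∀ m : ℕ, par E x = par E (x + m • uvec j) := by
    intro m
    induction m with
    | zero => simp
    | succ m ih =>
      rw [ih]
      have hstrip := par_add_par_uvec hE hj0 (x + m • uvec j)
      have hkey : ind E (x + m • uvec j, j) = 0 := by
        refine ind_of_not_mem fun he => ?_
        have hb := mem_boxKeys.1 (hEL he)
        simp only at hb
        rcases hb with hb | hb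
        · have := (mem_box.1 hb) 0
          rw [add_nsmul_uvec_apply, if_neg hj0.symm] at this; omega
        · have := (mem_box.1 hb) 0
          rw [add_uvec_apply, if_neg hj0.symm, add_nsmul_uvec_apply, if_neg hj0.symm] at this; omega
      rw [hkey] at hstrip
      rw [succ_nsmul, ← add_assoc]
      have key : ∀ a b : ZMod 2, a + b = 0 → a = b := by decide
      exact key _ _ hstrip
  rw [walk (2 * L + 1)]
  refine par_eq_zero_of_miss hEL (Or.inl ⟨j, hj0, Or.inr ?_⟩)
  have := (hside j hj0).1
  rw [add_nsmul_uvec_apply, if_pos rfl]; push_cast; omega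

/-- The parity configuration of a closed `E ⊆ ℰ^b_{B(L)}` is `+1` off the box (`d ≥ 2`). [cite: FriedliVelenik2017, Exercise 5.9] -/
theorem cfgOf_eq_one_of_not_mem_box (hd : 2 ≤ d) {E : Finset (Key d)} (hE : IsClosedKeys E) {L : ℕ}
    (hEL : E ⊆ boxKeys L) {x : Site d} (hx : x ∉ box d L) : cfgOf E x = 1 :=
  cfgOf_eq_one_iff.2 (par_eq_zero_of_not_mem_box hd hE hEL hx)

/-- The parity configuration of a closed `E ⊆ ℰ^b_{B(L)}` is a `+`-configuration (`d ≥ 2`). [cite: FriedliVelenik2017, Exercise 5.9] -/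
theorem isPlusCfg_cfgOf (hd : 2 ≤ d) {E : Finset (Key d)} (hE : IsClosedKeys E) {L : ℕ}
    (hEL : E ⊆ boxKeys L) : IsPlusCfg L (cfgOf E) := fun _ hx =>
  cfgOf_eq_one_of_not_mem_box hd hE hEL hx

/-- **Exercise 5.9, surjectivity half**: a closed `E ⊆ ℰ^b_{B(L)}` IS the disagreement set of its
parity configuration (`d ≥ 2`). [cite: FriedliVelenik2017, Exercise 5.9] -/
theorem disagree_cfgOf {E : Finset (Key d)} (hE : IsClosedKeys E) {L : ℕ}
    (hEL : E ⊆ boxKeys L) : disagree L (cfgOf E) = E := by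
  ext e
  rw [mem_disagree, ← sgn_add_sgn_eq_one_iff, sgn_cfgOf, sgn_cfgOf, par_add_par_tip hE]
  constructor
  · rintro ⟨-, h⟩
    by_contra he
    rw [ind_of_not_mem he] at h
    exact zero_ne_one h
  · intro he
    exact ⟨hEL he, ind_of_mem he⟩

/-- **Exercise 5.9, injectivity half**: a `+`-configuration is recovered from its disagreement set,
`ω_x = (-1)^{#(∂ω ∩ ray from x)}`. [cite: FriedliVelenik2017, §5.7.4 (p. 259, ω_i = (-1)^{#{γ : i ∈ Int γ}})] -/
theorem cfgOf_disagree {L : ℕ} {σ : SpinConfig (Site d)} (hσ : IsPlusCfg L σ) :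
    cfgOf (disagree L σ) = σ := by
  set D := disagree L σ with hD
  have climb : ∀ (x : Site d) (T : ℕ),
      par D x = sgn σ x + sgn σ (x + T • uvec 0) + par D (x + T • uvec 0) := by
    intro x T
    induction T with
    | zero => simp [zmod2_add_self]
    | succ T ih =>
      have e1 : x + (T + 1) • uvec 0 = x + T • uvec 0 + uvec 0 := by rw [succ_nsmul, add_assoc]
      rw [ih, par_eq D (x + T • uvec 0), ind_disagree hσ, e1]
      simp only
      have key : ∀ a b c p : ZMod 2, a + b + (b + c + p) = a + c + p := by decide
      exact key _ _ _ _
  funext x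
  obtain ⟨T, hT⟩ : ∃ T : ℕ, (L : ℤ) < x 0 + T := ⟨(L - x 0 + 1).toNat, by
    have := Int.self_le_toNat (L - x 0 + 1); omega⟩
  have hxT : (L : ℤ) < (x + T • uvec 0 : Site d) 0 := by rw [add_nsmul_uvec_apply, if_pos rfl]; exact hT
  have hout : x + T • uvec 0 ∉ box d L := fun h => by have := (mem_box.1 h) 0; omega
  have h := climb x T
  rw [par_eq_zero_of_miss (disagree_subset L σ) (Or.inr hxT), (sgn_eq_zero_iff).2 (hσ _ hout),
    add_zero, add_zero] at h
  -- `par D x = sgn σ x`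
  rcases units_int_eq_one_or (σ x) with hx | hx
  · rw [hx]; exact cfgOf_eq_one_iff.2 (h.trans (sgn_eq_zero_iff.2 hx))
  · rw [hx]
    have h1 : par D x = 1 := h.trans (sgn_eq_one_iff.2 hx)
    unfold cfgOf; rw [if_neg]; rw [h1]; exact one_ne_zero

/-- The parity configuration is the gluing of its restriction to the box with `+` outside. [cite: FriedliVelenik2017, Exercise 5.9] -/
theorem glue_restrict_cfgOf (hd : 2 ≤ d) {E : Finset (Key d)} (hE : IsClosedKeys E) {L : ℕ}
    (hEL : E ⊆ boxKeys L) : glue (box d L) (fun x : ↥(box d L) => cfgOf E x) .plus = cfgOf E := by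
  funext x
  by_cases hx : x ∈ box d L
  · rw [glue_apply_of_mem _ _ _ hx]
  · rw [glue_apply_of_notMem _ _ _ hx, cfgOf_eq_one_of_not_mem_box hd hE hEL hx]; rfl

/-- **Exercise 5.9 as a change of variables**: summing over the `+`-configurations of `B(L)` is
summing over the closed subsets of `ℰ^b_{B(L)}`, the configuration being the parity configuration of
the edge set (`d ≥ 2`). [cite: FriedliVelenik2017, Exercise 5.9 and eq. (5.42)] -/
theorem sum_plusConfig_eq_sum_closed (hd : 2 ≤ d) {M : Type*} [AddCommMonoid M] (L : ℕ)
    (F : SpinConfig (Site d) → M) :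
    ∑ τ : ↥(box d L) → ℤˣ, F (glue (box d L) τ .plus) = ∑ E ∈ closedSets L, F (cfgOf E) := by
  refine Finset.sum_nbij' (fun τ => disagree L (glue (box d L) τ .plus))
    (fun E => fun x : ↥(box d L) => cfgOf E x) ?_ ?_ ?_ ?_ ?_
  · intro τ _
    exact mem_closedSets.2 ⟨disagree_subset _ _, isClosedKeys_disagree (isPlusCfg_glue L τ)⟩
  · intro E _; exact mem_univ _
  · intro τ _
    funext x
    simp only [cfgOf_disagree (isPlusCfg_glue L τ), glue_apply_of_mem _ _ _ x.2]
  · intro E hE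
    obtain ⟨hEL, hEc⟩ := mem_closedSets.1 hE
    simp only [glue_restrict_cfgOf hd hEc hEL, disagree_cfgOf hEc hEL]
  · intro τ _
    simp only [cfgOf_disagree (isPlusCfg_glue L τ)]

end Ray

/-! ### A decidable form of adjacency -/

/-- A key lies on the plaquettes it spans. [folklore] -/
private theorem self_mem_plaqEdges_fst (x : Site d) (k l : Fin d) : (x, k) ∈ plaqEdges x k l := by
  simp [mem_plaqEdges]

/-- A key lies on the plaquettes behind it. [folklore] -/
private theorem self_mem_plaqEdges_sub (x : Site d) (k l : Fin d) : (x, k) ∈ plaqEdges (x - uvec l) k l := by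
  simp [mem_plaqEdges]

/-- The `2(d-1)` plaquettes through the key `(x, k)` are `(x; k, l)` and `(x - e_l; k, l)`, `l ≠ k`. [cite: FriedliVelenik2017, §5.7.4 (contours: plaquettes of ∂ℳ(ω), pp. 256–257)] -/
theorem adj_iff {e e' : Key d} :
    Adj e e' ↔ ∃ l : Fin d, l ≠ e.2 ∧ (e' ∈ plaqEdges e.1 e.2 l ∨ e' ∈ plaqEdges (e.1 - uvec l) e.2 l) := by
  obtain ⟨x, m⟩ := e
  constructor
  · rintro ⟨y, k, l, hkl, he, he'⟩
    rcases mem_plaqEdges.1 he with h | h | h | h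
    · obtain ⟨rfl, rfl⟩ := Prod.mk.inj h
      exact ⟨l, hkl.symm, Or.inl he'⟩
    · obtain ⟨rfl, rfl⟩ := Prod.mk.inj h
      exact ⟨k, hkl, Or.inl (by rwa [plaqEdges_comm])⟩
    · obtain ⟨rfl, rfl⟩ := Prod.mk.inj h
      refine ⟨k, hkl, Or.inr ?_⟩
      rwa [add_sub_cancel_right, plaqEdges_comm]
    · obtain ⟨rfl, rfl⟩ := Prod.mk.inj h
      refine ⟨l, hkl.symm, Or.inr ?_⟩
      rwa [add_sub_cancel_right]
  · rintro ⟨l, hl, h | h⟩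
    · exact ⟨x, m, l, hl.symm, self_mem_plaqEdges_fst x m l, h⟩
    · exact ⟨x - uvec l, m, l, hl.symm, self_mem_plaqEdges_sub x m l, h⟩

/-- Adjacency is decidable (through `adj_iff`). [folklore] -/
instance : DecidableRel (Adj (d := d)) := fun _ _ => decidable_of_iff _ adj_iff.symm

/-! ### Connected components and contours -/

/-- One adjacency step landing in `E`. [cite: FriedliVelenik2017, §5.7.4 (Γ'(ω) = maximal connected components of ∂ℳ(ω), p. 257)] -/
def StepIn (E : Finset (Key d)) (a b : Key d) : Prop := b ∈ E ∧ Adj a b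

/-- `a` and `b` are linked in `E`: a chain of plaquette-adjacent edges of `E` leads from `a` to `b`.
[cite: FriedliVelenik2017, §5.7.4 (maximal connected components of ∂ℳ(ω))] -/
def Linked (E : Finset (Key d)) (a b : Key d) : Prop := Relation.ReflTransGen (StepIn E) a b

/-- `E` is connected (through shared plaquettes). [cite: FriedliVelenik2017, §5.7.4 (contours are connected sets of plaquettes)] -/
def IsConn (E : Finset (Key d)) : Prop := ∀ a ∈ E, ∀ b ∈ E, Linked E a b

/-- A **contour**: a non-empty, closed, connected finite set of edges (dual plaquettes). [cite: FriedliVelenik2017, §5.7.4 (contours γ_i)] -/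
def IsContour (γ : Finset (Key d)) : Prop := γ.Nonempty ∧ IsClosedKeys γ ∧ IsConn γ

/-- The component of `a` in `E`. [cite: FriedliVelenik2017, §5.7.4 (Γ'(ω))] -/
def comp (E : Finset (Key d)) (a : Key d) : Finset (Key d) :=
  open Classical in E.filter (Linked E a)

/-- The family `Γ'(E)` of components of `E` (for `E = ∂ω`: the contours of `ω`). [cite: FriedliVelenik2017, §5.7.4 (Γ'(ω) = {γ₁,…,γ_n})] -/
def comps (E : Finset (Key d)) : Finset (Finset (Key d)) := E.image (comp E)

/-- Membership in a component. [cite: FriedliVelenik2017, §5.7.4 (Γ'(ω) = maximal connected components of ∂ℳ(ω), p. 257)] -/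
theorem mem_comp {E : Finset (Key d)} {a b : Key d} : b ∈ comp E a ↔ b ∈ E ∧ Linked E a b := by
  classical
  simp [comp]

/-- A component of `E` is part of `E`. [cite: FriedliVelenik2017, §5.7.4 (Γ'(ω) = maximal connected components of ∂ℳ(ω), p. 257)] -/
theorem comp_subset (E : Finset (Key d)) (a : Key d) : comp E a ⊆ E := fun _ h => (mem_comp.1 h).1

/-- Chains of `E` end in `E`. [cite: FriedliVelenik2017, §5.7.4 (Γ'(ω) = maximal connected components of ∂ℳ(ω), p. 257)] -/
theorem Linked.mem_of_mem {E : Finset (Key d)} {a b : Key d} (h : Linked E a b) (ha : a ∈ E) : b ∈ E := by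
  induction h with
  | refl => exact ha
  | tail _ hs _ => exact hs.1

/-- `Linked` is reflexive. [cite: FriedliVelenik2017, §5.7.4 (Γ'(ω) = maximal connected components of ∂ℳ(ω), p. 257)] -/
theorem linked_refl (E : Finset (Key d)) (a : Key d) : Linked E a a := Relation.ReflTransGen.refl

/-- `Linked` is transitive. [cite: FriedliVelenik2017, §5.7.4 (Γ'(ω) = maximal connected components of ∂ℳ(ω), p. 257)] -/
theorem Linked.trans {E : Finset (Key d)} {a b c : Key d} (h1 : Linked E a b) (h2 : Linked E b c) :
    Linked E a c := Relation.ReflTransGen.trans h1 h2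

/-- `Linked` is symmetric on `E`. [cite: FriedliVelenik2017, §5.7.4 (Γ'(ω) = maximal connected components of ∂ℳ(ω), p. 257)] -/
theorem Linked.symm {E : Finset (Key d)} {a b : Key d} (h : Linked E a b) (ha : a ∈ E) : Linked E b a := by
  induction h with
  | refl => exact Relation.ReflTransGen.refl
  | @tail x y hx hs ih => exact Relation.ReflTransGen.head ⟨Linked.mem_of_mem hx ha, hs.2.symm⟩ ih

/-- `Linked` is monotone in the edge set. [cite: FriedliVelenik2017, §5.7.4 (Γ'(ω) = maximal connected components of ∂ℳ(ω), p. 257)] -/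
theorem Linked.mono {E F : Finset (Key d)} (hEF : E ⊆ F) {a b : Key d} (h : Linked E a b) : Linked F a b := by
  induction h with
  | refl => exact Relation.ReflTransGen.refl
  | tail _ hs ih => exact Relation.ReflTransGen.tail ih ⟨hEF hs.1, hs.2⟩

/-- A point of `E` lies in its component. [cite: FriedliVelenik2017, §5.7.4 (Γ'(ω) = maximal connected components of ∂ℳ(ω), p. 257)] -/
theorem mem_comp_self {E : Finset (Key d)} {a : Key d} (ha : a ∈ E) : a ∈ comp E a :=
  mem_comp.2 ⟨ha, linked_refl E a⟩

/-- Linked points have the same component. [cite: FriedliVelenik2017, §5.7.4 (Γ'(ω) = maximal connected components of ∂ℳ(ω), p. 257)] -/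
theorem comp_eq_comp_of_linked {E : Finset (Key d)} {a b : Key d} (ha : a ∈ E) (h : Linked E a b) :
    comp E a = comp E b := by
  ext c
  rw [mem_comp, mem_comp]
  exact ⟨fun ⟨hc, hl⟩ => ⟨hc, (h.symm ha).trans hl⟩, fun ⟨hc, hl⟩ => ⟨hc, h.trans hl⟩⟩

/-- The component of a point of a component is that component. [cite: FriedliVelenik2017, §5.7.4 (Γ'(ω) = maximal connected components of ∂ℳ(ω), p. 257)] -/
theorem comp_eq_of_mem_comp {E : Finset (Key d)} {a b : Key d} (ha : a ∈ E) (hb : b ∈ comp E a) :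
    comp E b = comp E a :=
  (comp_eq_comp_of_linked ha (mem_comp.1 hb).2).symm

/-- Membership in the component family. [cite: FriedliVelenik2017, §5.7.4 (Γ'(ω) = maximal connected components of ∂ℳ(ω), p. 257)] -/
theorem mem_comps {E : Finset (Key d)} {γ : Finset (Key d)} : γ ∈ comps E ↔ ∃ a ∈ E, comp E a = γ := by
  simp [comps]

/-- The components partition `E`. [cite: FriedliVelenik2017, §5.7.4 (Γ'(ω) = maximal connected components of ∂ℳ(ω), p. 257)] -/
theorem biUnion_comps (E : Finset (Key d)) : (comps E).biUnion id = E := by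
  ext b
  simp only [mem_biUnion, id, mem_comps]
  constructor
  · rintro ⟨γ, ⟨a, -, rfl⟩, hb⟩; exact comp_subset E a hb
  · intro hb; exact ⟨comp E b, ⟨b, hb, rfl⟩, mem_comp_self hb⟩

/-- Distinct components are disjoint. [cite: FriedliVelenik2017, §5.7.4 (Γ'(ω) = maximal connected components of ∂ℳ(ω), p. 257)] -/
theorem pairwiseDisjoint_comps (E : Finset (Key d)) : ((comps E : Finset (Finset (Key d))) : Set (Finset (Key d))).PairwiseDisjoint id := by
  intro γ hγ γ' hγ' hne
  obtain ⟨a, ha, rfl⟩ := mem_comps.1 hγ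
  obtain ⟨a', ha', rfl⟩ := mem_comps.1 hγ'
  rw [Function.onFun, id, id, Finset.disjoint_left]
  intro c hc hc'
  exact hne ((comp_eq_of_mem_comp ha hc).symm.trans (comp_eq_of_mem_comp ha' hc'))

/-- `|E| = Σ_{γ ∈ Γ'(E)} |γ|` (so that `e^{-2β|∂ω|} = ∏_γ e^{-2β|γ|}`). [cite: FriedliVelenik2017, §5.7.4 (|∂_e Λ^-(ω)| = Σ_i |γ_i|, p. 257)] -/
theorem sum_card_comps (E : Finset (Key d)) : ∑ γ ∈ comps E, γ.card = E.card := by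
  conv_rhs => rw [← biUnion_comps E]
  rw [card_biUnion (pairwiseDisjoint_comps E)]
  rfl

/-- A chain of `E` starting in a component stays in it. [cite: FriedliVelenik2017, §5.7.4 (Γ'(ω) = maximal connected components of ∂ℳ(ω), p. 257)] -/
theorem Linked.linked_comp {E : Finset (Key d)} {a b c : Key d} (h : Linked E b c) (hb : b ∈ comp E a) :
    Linked (comp E a) b c := by
  induction h with
  | refl => exact Relation.ReflTransGen.refl
  | @tail x y hx hs ih =>
    refine Relation.ReflTransGen.tail ih ⟨?_, hs.2⟩
    have hxa : x ∈ comp E a := Linked.mem_of_mem ih hb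
    obtain ⟨-, hax⟩ := mem_comp.1 hxa
    exact mem_comp.2 ⟨hs.1, hax.tail hs⟩

/-- Components are connected. [cite: FriedliVelenik2017, §5.7.4 (Γ'(ω) = maximal connected components of ∂ℳ(ω), p. 257)] -/
theorem isConn_comp {E : Finset (Key d)} {a : Key d} (ha : a ∈ E) : IsConn (comp E a) := by
  intro b hb c hc
  obtain ⟨-, hab⟩ := mem_comp.1 hb
  obtain ⟨-, hac⟩ := mem_comp.1 hc
  exact ((hab.symm ha).trans hac).linked_comp hb

/-- The plaquette parity only sees the four edges of the plaquette. [cite: FriedliVelenik2017, §5.7.4 (contours: plaquettes of ∂ℳ(ω), pp. 256–257)] -/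
theorem plaqParity_congr {E F : Finset (Key d)} {y : Site d} {k l : Fin d}
    (h : ∀ e ∈ plaqEdges y k l, (e ∈ E ↔ e ∈ F)) : plaqParity E y k l = plaqParity F y k l := by
  have h' : ∀ e ∈ plaqEdges y k l, ind E e = ind F e := fun e he => by
    unfold ind; rw [if_congr (h e he) rfl rfl]
  simp only [plaqParity]
  rw [h' _ (by simp [mem_plaqEdges]), h' (y, l) (by simp [mem_plaqEdges]),
    h' (y + uvec k, l) (by simp [mem_plaqEdges]), h' (y + uvec l, k) (by simp [mem_plaqEdges])]

/-- A plaquette missing `E` has parity zero. [cite: FriedliVelenik2017, §5.7.4 (contours: plaquettes of ∂ℳ(ω), pp. 256–257)] -/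
theorem plaqParity_eq_zero_of_forall {E : Finset (Key d)} {y : Site d} {k l : Fin d}
    (h : ∀ e ∈ plaqEdges y k l, e ∉ E) : plaqParity E y k l = 0 := by
  rw [plaqParity_congr (F := ∅) (fun e he => by simp [h e he])]
  simp [plaqParity, ind_empty]

/-- Components of a closed set are closed: a plaquette meeting a component has all its `E`-edges in
that component. [cite: FriedliVelenik2017, §5.7.4 (each γ_i is a closed surface)] -/
theorem isClosedKeys_comp {E : Finset (Key d)} (hE : IsClosedKeys E) (a : Key d) :
    IsClosedKeys (comp E a) := by
  intro y k l hkl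
  by_cases hmeet : ∃ e₀ ∈ plaqEdges y k l, e₀ ∈ comp E a
  · obtain ⟨e₀, he₀p, he₀⟩ := hmeet
    rw [plaqParity_congr (F := E) (fun e he => ?_)]
    · exact hE y k l hkl
    refine ⟨fun h => comp_subset E a h, fun heE => ?_⟩
    obtain ⟨-, hl⟩ := mem_comp.1 he₀
    exact mem_comp.2 ⟨heE, hl.tail ⟨heE, y, k, l, hkl, he₀p, he⟩⟩
  · push Not at hmeet
    exact plaqParity_eq_zero_of_forall hmeet

/-- Components are non-empty. [cite: FriedliVelenik2017, §5.7.4 (Γ'(ω) = maximal connected components of ∂ℳ(ω), p. 257)] -/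
theorem comp_nonempty {E : Finset (Key d)} {a : Key d} (ha : a ∈ E) : (comp E a).Nonempty := ⟨a, mem_comp_self ha⟩

/-- **The components of a closed edge set are contours.** [cite: FriedliVelenik2017, §5.7.4 (Γ'(ω) ⊆ Γ_Λ)] -/
theorem isContour_of_mem_comps {E : Finset (Key d)} (hE : IsClosedKeys E) {γ : Finset (Key d)}
    (hγ : γ ∈ comps E) : IsContour γ := by
  obtain ⟨a, ha, rfl⟩ := mem_comps.1 hγ
  exact ⟨comp_nonempty ha, isClosedKeys_comp hE a, isConn_comp ha⟩

/-- Members of the component family are parts of `E`. [cite: FriedliVelenik2017, §5.7.4 (Γ'(ω) = maximal connected components of ∂ℳ(ω), p. 257)] -/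
theorem subset_of_mem_comps {E : Finset (Key d)} {γ : Finset (Key d)} (hγ : γ ∈ comps E) : γ ⊆ E := by
  obtain ⟨a, -, rfl⟩ := mem_comps.1 hγ; exact comp_subset E a

/-! ### Incompatibility of contours and the polymer-gas identity -/

/-- Incompatibility of contours: equal, or sharing a plaquette (F–V: `γ ∩ γ' ≠ ∅` in `ℝ^d`, the
hard-core interaction `δ` of (5.43)). Reflexive and symmetric. [cite: FriedliVelenik2017, §5.7.4 eq. (5.43)] -/
def ContourInc (γ γ' : Finset (Key d)) : Prop := γ = γ' ∨ ∃ a ∈ γ, ∃ b ∈ γ', Adj a b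

/-- Incompatibility is decidable. [folklore] -/
instance : DecidableRel (ContourInc (d := d)) := fun _ _ => inferInstanceAs (Decidable (_ ∨ _))

/-- Incompatibility is reflexive (as in [KP86, §2]). [cite: FriedliVelenik2017, §5.7.4 eq. (5.43)] -/
instance : Std.Refl (ContourInc (d := d)) := ⟨fun _ => Or.inl rfl⟩

/-- Incompatibility is symmetric. [cite: FriedliVelenik2017, §5.7.4 eq. (5.43)] -/
instance : Std.Symm (ContourInc (d := d)) :=
  ⟨fun _ _ h => h.elim (fun h => Or.inl h.symm) fun ⟨a, ha, b, hb, hab⟩ => Or.inr ⟨b, hb, a, ha, hab.symm⟩⟩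

/-- Contours sharing an edge are incompatible (`d ≥ 2`). [cite: FriedliVelenik2017, Exercise 5.9] -/
theorem contourInc_of_mem_mem (hd : 2 ≤ d) {γ γ' : Finset (Key d)} {a : Key d} (ha : a ∈ γ) (ha' : a ∈ γ') :
    ContourInc γ γ' := Or.inr ⟨a, ha, a, ha', Adj.refl hd a⟩

/-- **The components of a closed set are pairwise compatible.** [cite: FriedliVelenik2017, Exercise 5.9 (only if)] -/
theorem isCompatible_comps (E : Finset (Key d)) : IsCompatible ContourInc (comps E) := by
  intro γ hγ γ' hγ' hne hinc
  rcases hinc with h | ⟨a, ha, b, hb, hab⟩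
  · exact hne h
  obtain ⟨x, hx, rfl⟩ := mem_comps.1 hγ
  obtain ⟨x', hx', rfl⟩ := mem_comps.1 hγ'
  have hbE : b ∈ E := comp_subset E x' hb
  obtain ⟨-, hxa⟩ := mem_comp.1 ha
  have hb' : b ∈ comp E x := mem_comp.2 ⟨hbE, hxa.tail ⟨hbE, hab⟩⟩
  exact hne ((comp_eq_of_mem_comp hx hb').symm.trans (comp_eq_of_mem_comp hx' hb))

/-- Distinct compatible contours are disjoint (`d ≥ 2`). [cite: FriedliVelenik2017, Exercise 5.9] -/
theorem pairwiseDisjoint_of_isCompatible (hd : 2 ≤ d) {X : Finset (Finset (Key d))}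
    (hc : IsCompatible ContourInc X) : (X : Set (Finset (Key d))).PairwiseDisjoint id := by
  intro γ hγ γ' hγ' hne
  rw [Function.onFun, id, id, Finset.disjoint_left]
  intro a ha ha'
  exact hc hγ hγ' hne (contourInc_of_mem_mem hd ha ha')

/-- In a compatible family of contours, the component (in the union) of a point of `γ` is `γ`. [cite: FriedliVelenik2017, Exercise 5.9 (if)] -/
theorem comp_biUnion_eq {X : Finset (Finset (Key d))} (hX : ∀ γ ∈ X, IsContour γ)
    (hc : IsCompatible ContourInc X) {γ : Finset (Key d)} (hγ : γ ∈ X) {a : Key d} (ha : a ∈ γ) :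
    comp (X.biUnion id) a = γ := by
  have hγU : γ ⊆ X.biUnion id := fun b hb => mem_biUnion.2 ⟨γ, hγ, hb⟩
  ext b
  rw [mem_comp]
  constructor
  · rintro ⟨-, hl⟩
    -- a chain from `a ∈ γ` through the union never leaves `γ`
    suffices h : ∀ c, Linked (X.biUnion id) a c → c ∈ γ from h b hl
    intro c hlc
    induction hlc with
    | refl => exact ha
    | @tail x y _ hs ih =>
      obtain ⟨hyU, hxy⟩ := hs
      obtain ⟨γ', hγ', hy⟩ := mem_biUnion.1 hyU
      by_contra hyγ
      have hne : γ ≠ γ' := fun h => hyγ (h ▸ hy)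
      exact hc hγ hγ' hne (Or.inr ⟨x, ih, y, hy, hxy⟩)
  · intro hb
    exact ⟨hγU hb, ((hX γ hγ).2.2 a ha b hb).mono hγU⟩

/-- **Exercise 5.9 (if)**: a compatible family of contours is the component family of its union. [cite: FriedliVelenik2017, Exercise 5.9] -/
theorem comps_biUnion_of_isCompatible {X : Finset (Finset (Key d))} (hX : ∀ γ ∈ X, IsContour γ)
    (hc : IsCompatible ContourInc X) : comps (X.biUnion id) = X := by
  ext γ
  rw [mem_comps]
  constructor
  · rintro ⟨a, haU, rfl⟩
    obtain ⟨γ', hγ', ha⟩ := mem_biUnion.1 haU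
    rw [comp_biUnion_eq hX hc hγ' ha]; exact hγ'
  · intro hγ
    obtain ⟨a, ha⟩ := (hX γ hγ).1
    exact ⟨a, mem_biUnion.2 ⟨γ, hγ, ha⟩, comp_biUnion_eq hX hc hγ ha⟩

/-- The union of a compatible family of contours is closed (at most one member meets a given
plaquette). [cite: FriedliVelenik2017, Exercise 5.9] -/
theorem isClosedKeys_biUnion_of_isCompatible {X : Finset (Finset (Key d))} (hX : ∀ γ ∈ X, IsContour γ)
    (hc : IsCompatible ContourInc X) : IsClosedKeys (X.biUnion id) := by
  intro y k l hkl
  by_cases hmeet : ∃ e₀ ∈ plaqEdges y k l, e₀ ∈ X.biUnion id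
  · obtain ⟨e₀, he₀p, he₀⟩ := hmeet
    obtain ⟨γ, hγ, he₀γ⟩ := mem_biUnion.1 he₀
    rw [plaqParity_congr (F := γ) (fun e he => ?_)]
    · exact (hX γ hγ).2.1 y k l hkl
    refine ⟨fun heU => ?_, fun heγ => mem_biUnion.2 ⟨γ, hγ, heγ⟩⟩
    obtain ⟨γ', hγ', heγ'⟩ := mem_biUnion.1 heU
    by_contra heγ
    have hne : γ ≠ γ' := fun h => heγ (h ▸ heγ')
    exact hc hγ hγ' hne (Or.inr ⟨e₀, he₀γ, e, heγ', y, k, l, hkl, he₀p, he⟩)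
  · push Not at hmeet
    exact plaqParity_eq_zero_of_forall hmeet

/-- The contours inside `ℰ^b_{B(L)}` — the polymer set `Γ_Λ` of the volume `B(L)`. [cite: FriedliVelenik2017, §5.7.4 (Γ_Λ)] -/
def contoursIn (L : ℕ) : Finset (Finset (Key d)) :=
  open Classical in (boxKeys (d := d) L).powerset.filter IsContour

/-- Membership in `Γ_{B(L)}`. [cite: FriedliVelenik2017, §5.7.4 (Γ_Λ, p. 257)] -/
theorem mem_contoursIn {L : ℕ} {γ : Finset (Key d)} : γ ∈ contoursIn L ↔ γ ⊆ boxKeys L ∧ IsContour γ := by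
  classical
  simp [contoursIn]

/-- `Γ'(ω) ⊆ Γ_Λ`: the contours of a configuration of `B(L)` are contours of `B(L)`. [cite: FriedliVelenik2017, §5.7.4 (Γ_Λ, p. 257)] -/
theorem comps_subset_contoursIn {L : ℕ} {E : Finset (Key d)} (hE : E ∈ closedSets L) : comps E ⊆ contoursIn L := by
  intro γ hγ
  obtain ⟨hEL, hEc⟩ := mem_closedSets.1 hE
  exact mem_contoursIn.2 ⟨(subset_of_mem_comps hγ).trans hEL, isContour_of_mem_comps hEc hγ⟩

/-- **The polymer-gas identity (5.42)/(5.43)**: summing a multiplicative contour weight over the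
closed edge sets of `ℰ^b_{B(L)}` is the hard-core polymer partition function of the contours of
`B(L)`. [cite: FriedliVelenik2017, §5.7.4 eqs. (5.42)–(5.43)] -/
theorem sum_closedSets_prod_comps (L : ℕ) (f : Finset (Key d) → ℂ) :
    ∑ E ∈ closedSets L, ∏ γ ∈ comps E, f γ = polymerPartitionFunction ContourInc f (contoursIn L) := by
  unfold polymerPartitionFunction
  rw [← Finset.sum_filter]
  refine Finset.sum_nbij' comps (fun X => X.biUnion id) ?_ ?_ ?_ ?_ ?_
  · intro E hE
    exact mem_filter.2 ⟨mem_powerset.2 (comps_subset_contoursIn hE), isCompatible_comps E⟩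
  · intro X hX
    obtain ⟨hXsub, hXc⟩ := mem_filter.1 hX
    have hX' : ∀ γ ∈ X, IsContour γ := fun γ hγ => (mem_contoursIn.1 (mem_powerset.1 hXsub hγ)).2
    refine mem_closedSets.2 ⟨fun e he => ?_, isClosedKeys_biUnion_of_isCompatible hX' hXc⟩
    obtain ⟨γ, hγ, heγ⟩ := mem_biUnion.1 he
    exact (mem_contoursIn.1 (mem_powerset.1 hXsub hγ)).1 heγ
  · intro E _; exact biUnion_comps E
  · intro X hX
    obtain ⟨hXsub, hXc⟩ := mem_filter.1 hX
    exact comps_biUnion_of_isCompatible (fun γ hγ => (mem_contoursIn.1 (mem_powerset.1 hXsub hγ)).2) hXc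
  · intro E _; rfl

/-! ### `ω_i = ∏_γ (ω^γ)_i`: the configuration is multiplicative over the contours -/

section RayProduct

variable [NeZero d]

/-- `(cfgOf E)_x = (-1)^{rayCount E x}` as a real number. [cite: FriedliVelenik2017, §5.7.4 (Int γ and ω_i = (-1)^#, p. 259)] -/
theorem spinAt_cfgOf (E : Finset (Key d)) (x : Site d) : spinAt x (cfgOf E) = (-1 : ℝ) ^ rayCount E x := by
  unfold spinAt cfgOf par
  by_cases h : Even (rayCount E x)
  · rw [if_pos (ZMod.natCast_eq_zero_iff_even.2 h), h.neg_one_pow]; simp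
  · rw [if_neg (fun h' => h (ZMod.natCast_eq_zero_iff_even.1 h')), (Nat.not_even_iff_odd.1 h).neg_one_pow]
    simp

/-- Ray keys of a union. [folklore] -/
private theorem rayKeys_biUnion (X : Finset (Finset (Key d))) (x : Site d) :
    rayKeys (X.biUnion id) x = X.biUnion fun γ => rayKeys γ x := by
  unfold rayKeys
  rw [filter_biUnion]
  rfl

/-- Ray counts add over a disjoint family (`#{γ : i ∈ Int γ}` as a sum). [cite: FriedliVelenik2017, §5.7.4 (Int γ and ω_i = (-1)^#, p. 259)] -/
theorem rayCount_biUnion {X : Finset (Finset (Key d))} (hX : (X : Set (Finset (Key d))).PairwiseDisjoint id)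
    (x : Site d) : rayCount (X.biUnion id) x = ∑ γ ∈ X, rayCount γ x := by
  unfold rayCount
  rw [rayKeys_biUnion, card_biUnion]
  intro γ hγ γ' hγ' hne
  exact disjoint_filter_filter ((hX hγ hγ' hne))

/-- `(cfgOf ⋃X)_x = ∏_{γ ∈ X} (cfgOf γ)_x` for a pairwise disjoint family: the ray counts add.
[cite: FriedliVelenik2017, §5.7.4 (p. 259: ω_i = (-1)^{Σ_γ #…})] -/
theorem spinAt_cfgOf_biUnion {X : Finset (Finset (Key d))} (hX : (X : Set (Finset (Key d))).PairwiseDisjoint id)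
    (x : Site d) : spinAt x (cfgOf (X.biUnion id)) = ∏ γ ∈ X, spinAt x (cfgOf γ) := by
  simp only [spinAt_cfgOf]
  rw [rayCount_biUnion hX, Finset.prod_pow_eq_pow_sum]

/-- `σ_A(ω) = ∏_{γ ∈ Γ'(ω)} σ_A(ω^γ)`. [cite: FriedliVelenik2017, §5.7.4 (p. 259: σ_A(ω) = ∏_γ (-1)^{#{i ∈ A : i ∈ Int γ}})] -/
theorem spinProduct_cfgOf_biUnion {X : Finset (Finset (Key d))} (hX : (X : Set (Finset (Key d))).PairwiseDisjoint id)
    (A : Finset (Site d)) : spinProduct A (cfgOf (X.biUnion id)) = ∏ γ ∈ X, spinProduct A (cfgOf γ) := by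
  unfold spinProduct
  simp_rw [spinAt_cfgOf_biUnion hX]
  exact Finset.prod_comm

/-- `σ_A(ω) = ∏_{γ ∈ Γ'(ω)} σ_A(ω^γ)` for the component family of a closed set. [cite: FriedliVelenik2017, §5.7.4 (Int γ and ω_i = (-1)^#, p. 259)] -/
theorem spinProduct_cfgOf_eq_prod_comps (E : Finset (Key d)) (A : Finset (Site d)) :
    spinProduct A (cfgOf E) = ∏ γ ∈ comps E, spinProduct A (cfgOf γ) := by
  rw [← spinProduct_cfgOf_biUnion (pairwiseDisjoint_comps E), biUnion_comps]

end RayProduct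

/-! ### Edges of the box and the Hamiltonian (5.39)–(5.41) -/

/-- The edge `{x, x + e_k}` of the key `(x, k)`. [folklore] -/
def toEdge (e : Key d) : Sym2 (Site d) := s(e.1, e.1 + uvec e.2)

/-- `x ∼ x + e_k` in `ℤ^d`. [cite: FriedliVelenik2017, §3.1 (ℤ^d: nearest neighbours x, x + e_k; ℰ_Λ^b)] -/
theorem zdGraph_adj_add_uvec (x : Site d) (k : Fin d) : (zdGraph d).Adj x (x + uvec k) :=
  (zdGraph_adj_iff x _).2 ⟨k, Or.inl rfl⟩

/-- Keys are edges of `ℤ^d`. [cite: FriedliVelenik2017, §3.1 (ℤ^d: nearest neighbours x, x + e_k; ℰ_Λ^b)] -/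
theorem toEdge_mem_edgeSet (e : Key d) : toEdge e ∈ (zdGraph d).edgeSet := by
  rw [toEdge, SimpleGraph.mem_edgeSet]; exact zdGraph_adj_add_uvec e.1 e.2

/-- `e_k + e_l ≠ 0`. [folklore] -/
private theorem uvec_add_uvec_ne_zero (k l : Fin d) : uvec k + uvec l ≠ (0 : Site d) := by
  intro h
  have := congrFun h k
  simp only [Pi.add_apply, uvec_apply_same, uvec_apply, Pi.zero_apply] at this
  split_ifs at this <;> omega

/-- Distinct keys are distinct edges. [cite: FriedliVelenik2017, §3.1 (ℤ^d: nearest neighbours x, x + e_k; ℰ_Λ^b)] -/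
theorem toEdge_injective : Function.Injective (toEdge (d := d)) := by
  rintro ⟨x, k⟩ ⟨x', k'⟩ h
  simp only [toEdge, Sym2.eq_iff] at h
  rcases h with ⟨rfl, h2⟩ | ⟨h1, h2⟩
  · exact Prod.ext rfl (uvec_injective (add_left_cancel h2))
  · exfalso
    rw [h1, add_assoc] at h2
    have : uvec k' + uvec k = 0 := by simpa using h2
    exact uvec_add_uvec_ne_zero k' k this

/-- `ℰ^b_{B(L)}` is the image of `boxKeys L` under `toEdge`. [cite: FriedliVelenik2017, §3.1 (ℰ_Λ^b)] -/
theorem edgesTouching_box_eq_image (L : ℕ) : edgesTouching (zdGraph d) (box d L) = (boxKeys L).image toEdge := by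
  ext e
  rw [mem_edgesTouching_iff, mem_image]
  constructor
  · rintro ⟨he, z, hz, hze⟩
    induction e using Sym2.ind with
    | _ a b =>
      rw [SimpleGraph.mem_edgeSet] at he
      obtain ⟨i, h | h⟩ := (zdGraph_adj_iff a b).1 he
      · refine ⟨(a, i), mem_boxKeys.2 ?_, ?_⟩
        · rcases Sym2.mem_iff.1 hze with rfl | rfl
          · exact Or.inl hz
          · exact Or.inr (h ▸ hz)
        · simp [toEdge, uvec, h]
      · refine ⟨(b, i), mem_boxKeys.2 ?_, ?_⟩
        · rcases Sym2.mem_iff.1 hze with rfl | rfl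
          · exact Or.inr (h ▸ hz)
          · exact Or.inl hz
        · simp only [toEdge, uvec, ← h]; exact Sym2.eq_swap
  · rintro ⟨q, hq, rfl⟩
    refine ⟨toEdge_mem_edgeSet q, ?_⟩
    rcases mem_boxKeys.1 hq with h | h
    · exact ⟨q.1, h, Sym2.mem_mk_left _ _⟩
    · exact ⟨_, h, Sym2.mem_mk_right _ _⟩

/-- `σ_xσ_y = 1 - 2·𝟙[σ_x ≠ σ_y]`. [folklore] -/
private theorem spinAt_mul_spinAt_eq (σ : SpinConfig (Site d)) (x y : Site d) :
    spinAt x σ * spinAt y σ = 1 - 2 * (if σ x ≠ σ y then 1 else 0) := by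
  unfold spinAt
  rcases units_int_eq_one_or (σ x) with hx | hx <;> rcases units_int_eq_one_or (σ y) with hy | hy <;>
    norm_num [hx, hy]

/-- **(5.39)**: `∑_{e ∈ ℰ^b_{B(L)}} σ_e = |ℰ^b_{B(L)}| - 2|∂σ|`. [cite: FriedliVelenik2017, §5.7.4 eq. (5.39)] -/
theorem sum_bondSpin_eq (L : ℕ) (σ : SpinConfig (Site d)) :
    ∑ e ∈ edgesTouching (zdGraph d) (box d L), bondSpin σ e =
      ((boxKeys (d := d) L).card : ℝ) - 2 * (disagree L σ).card := by
  rw [edgesTouching_box_eq_image, sum_image fun _ _ _ _ h => toEdge_injective h]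
  simp only [toEdge, bondSpin_mk, spinAt_mul_spinAt_eq]
  rw [Finset.sum_sub_distrib, Finset.sum_const, nsmul_eq_mul, mul_one, ← Finset.mul_sum, Finset.sum_boole]
  rfl

/-- **(5.40)–(5.41)**: the Boltzmann weight of a `+`-configuration at zero field is
`e^{β|ℰ^b|} e^{-2β|∂σ|}`. [cite: FriedliVelenik2017, §5.7.4 eqs. (5.40)–(5.41)] -/
theorem isingWeight_plus_box_eq (L : ℕ) (β : ℝ) (τ : ↥(box d L) → ℤˣ) :
    isingWeight (zdGraph d) (box d L) β 0 .plus τ =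
      Real.exp (β * (boxKeys (d := d) L).card) * Real.exp (-(2 * β * (disagree L (glue (box d L) τ .plus)).card)) := by
  rw [isingWeight, isingHamiltonian, show (BoundaryCondition.plus : BoundaryCondition (Site d)) = .fixed 1 from rfl,
    interactionEdges_fixed, sum_bondSpin_eq, ← Real.exp_add]
  congr 1; ring

section Weights

variable [NeZero d]

/-- The low-temperature contour activity `w_β(γ) = e^{-2β|γ|}` (as a complex number, for the tree's
polymer-gas vocabulary). [cite: FriedliVelenik2017, §5.7.4 eq. (5.41)] -/
def ltWeight (β : ℝ) (γ : Finset (Key d)) : ℂ := (Real.exp (-(2 * β * γ.card)) : ℂ)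

/-- The signed activity `w^A_β(γ) = σ_A(ω^γ) e^{-2β|γ|} = (-1)^{#{i ∈ A : i ∈ Int γ}} w_β(γ)`.
[cite: FriedliVelenik2017, §5.7.4 (w^A_β, p. 259)] -/
def ltWeightObs (β : ℝ) (A : Finset (Site d)) (γ : Finset (Key d)) : ℂ :=
  ((spinProduct A (cfgOf γ) * Real.exp (-(2 * β * γ.card)) : ℝ) : ℂ)

/-- `w^∅ = w`. [cite: FriedliVelenik2017, §5.7.4 eq. (5.46) (A = ∅)] -/
theorem ltWeightObs_empty (β : ℝ) (γ : Finset (Key d)) : ltWeightObs β ∅ γ = ltWeight β γ := by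
  simp [ltWeightObs, ltWeight, spinProduct]

/-- `|w^A_β(γ)| = e^{-2β|γ|}`. [cite: FriedliVelenik2017, §5.7.4 eq. (5.41) and p. 259 (|w^A_β(γ)| = |w_β(γ)|)] -/
theorem norm_ltWeightObs (β : ℝ) (A : Finset (Site d)) (γ : Finset (Key d)) :
    ‖ltWeightObs β A γ‖ = Real.exp (-(2 * β * γ.card)) := by
  rw [ltWeightObs, Complex.norm_real, Real.norm_eq_abs, abs_mul, abs_spinProduct, one_mul,
    abs_of_pos (Real.exp_pos _)]

/-- `|w_β(γ)| = e^{-2β|γ|}`. [cite: FriedliVelenik2017, §5.7.4 eq. (5.41) and p. 259 (|w^A_β(γ)| = |w_β(γ)|)] -/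
theorem norm_ltWeight (β : ℝ) (γ : Finset (Key d)) : ‖ltWeight β γ‖ = Real.exp (-(2 * β * γ.card)) := by
  rw [← ltWeightObs_empty, norm_ltWeightObs]

omit [NeZero d] in
/-- `e^{-2β|∂ω|} = ∏_{γ ∈ Γ'(ω)} e^{-2β|γ|}`. [cite: FriedliVelenik2017, §5.7.4 eqs. (5.41)–(5.42)] -/
theorem exp_card_eq_prod_comps (β : ℝ) (E : Finset (Key d)) :
    Real.exp (-(2 * β * E.card)) = ∏ γ ∈ comps E, Real.exp (-(2 * β * γ.card)) := by
  rw [← sum_card_comps E, ← Real.exp_sum]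
  congr 1; push_cast; rw [Finset.mul_sum, ← Finset.sum_neg_distrib]

/-- The numerator of (5.46): `∑_ω σ_A(ω) e^{-βH(ω)} = e^{β|ℰ^b|} Ξ^{LT,A}`. [cite: FriedliVelenik2017, §5.7.4 eq. (5.46)] -/
theorem sum_isingWeight_mul_spinProduct_eq (hd : 2 ≤ d) (L : ℕ) (β : ℝ) (A : Finset (Site d)) :
    ((∑ τ : ↥(box d L) → ℤˣ, isingWeight (zdGraph d) (box d L) β 0 .plus τ *
        spinProduct A (glue (box d L) τ .plus) : ℝ) : ℂ) =
      (Real.exp (β * (boxKeys (d := d) L).card) : ℂ) * polymerPartitionFunction ContourInc (ltWeightObs β A) (contoursIn L) := by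
  have hw : ∀ τ : ↥(box d L) → ℤˣ, isingWeight (zdGraph d) (box d L) β 0 .plus τ * spinProduct A (glue (box d L) τ .plus) =
      Real.exp (β * (boxKeys (d := d) L).card) *
        (Real.exp (-(2 * β * (disagree L (glue (box d L) τ .plus)).card)) * spinProduct A (glue (box d L) τ .plus)) :=
    fun τ => by rw [isingWeight_plus_box_eq, mul_assoc]
  simp only [hw]
  rw [← Finset.mul_sum, Complex.ofReal_mul]
  congr 1
  have key := sum_plusConfig_eq_sum_closed hd L
    (fun σ => Real.exp (-(2 * β * (disagree L σ).card)) * spinProduct A σ)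
  rw [key, ← sum_closedSets_prod_comps, Complex.ofReal_sum]
  refine sum_congr rfl fun E hE => ?_
  obtain ⟨hEL, hEc⟩ := mem_closedSets.1 hE
  rw [disagree_cfgOf hEc hEL, exp_card_eq_prod_comps, spinProduct_cfgOf_eq_prod_comps, ← prod_mul_distrib,
    Complex.ofReal_prod]
  refine prod_congr rfl fun γ _ => ?_
  rw [mul_comm]; rfl

/-- **(5.42)**: `Z⁺_{B(L);β,0} = e^{β|ℰ^b_{B(L)}|} Ξ^{LT}_{B(L);β}`. [cite: FriedliVelenik2017, §5.7.4 eq. (5.42)] -/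
theorem isingPartitionFunction_plus_box_eq (hd : 2 ≤ d) (L : ℕ) (β : ℝ) :
    (isingPartitionFunction (zdGraph d) (box d L) β 0 .plus : ℂ) =
      (Real.exp (β * (boxKeys (d := d) L).card) : ℂ) *
        polymerPartitionFunction ContourInc (ltWeight (d := d) β) (contoursIn L) := by
  have h := sum_isingWeight_mul_spinProduct_eq hd L β ∅
  simp only [spinProduct, prod_empty, mul_one] at h
  rw [isingPartitionFunction, h]
  congr 1
  exact polymerPartitionFunction_congr fun γ _ => ltWeightObs_empty β γ

/-- **(5.46)**: `⟨σ_A⟩⁺_{B(L);β,0} = Ξ^{LT,A}/Ξ^{LT}`. [cite: FriedliVelenik2017, §5.7.4 eq. (5.46)] -/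
theorem isingCorr_plus_box_eq_ratio (hd : 2 ≤ d) (L : ℕ) (β : ℝ) (A : Finset (Site d)) :
    (isingCorr (zdGraph d) (box d L) β 0 .plus A : ℂ) =
      polymerPartitionFunction ContourInc (ltWeightObs β A) (contoursIn L) /
        polymerPartitionFunction ContourInc (ltWeight (d := d) β) (contoursIn L) := by
  rw [isingCorr, isingExpect, integral_isingMeasure _ _ _ _ _ (measurable_spinProduct A), Complex.ofReal_div,
    sum_isingWeight_mul_spinProduct_eq hd, isingPartitionFunction_plus_box_eq hd,
    mul_div_mul_left _ _ (Complex.ofReal_ne_zero.2 (Real.exp_pos _).ne')]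

end Weights

/-! ### The move system realising adjacency (for the contour counting, F–V Lemma 3.38) -/

/-- The six plaquette-mates of the key `(x, k)` in the two plaquettes `(x; k, l)`, `(x - e_l; k, l)`
(junk: the identity when `l = k`). [cite: FriedliVelenik2017, Lemma 3.38 (moves of the covering walk)] -/
def keyStep (μ : Fin d × Fin 6) (e : Key d) : Key d :=
  if μ.1 = e.2 then e else
    (![(e.1, μ.1), (e.1 + uvec e.2, μ.1), (e.1 + uvec μ.1, e.2), (e.1 - uvec μ.1, μ.1),
        (e.1 - uvec μ.1 + uvec e.2, μ.1), (e.1 - uvec μ.1, e.2)] : Fin 6 → Key d) μ.2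

/-- Every move is undone by a move (re-rooting of covering walks). [cite: FriedliVelenik2017, Lemma 3.38 and Exercise 5.10] -/
theorem keyStep_inv (μ : Fin d × Fin 6) (e : Key d) : ∃ μ', keyStep μ' (keyStep μ e) = e := by
  obtain ⟨l, c⟩ := μ
  obtain ⟨x, k⟩ := e
  by_cases hl : l = k
  · exact ⟨(l, c), by simp [keyStep, hl]⟩
  fin_cases c
  · exact ⟨(k, 0), by simp [keyStep, hl, Ne.symm hl]⟩
  · exact ⟨(k, 3), by simp [keyStep, hl, Ne.symm hl]⟩
  · exact ⟨(l, 5), by simp [keyStep, hl]⟩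
  · exact ⟨(k, 1), by simp [keyStep, hl, Ne.symm hl]⟩
  · refine ⟨(k, 4), ?_⟩
    show keyStep (k, 4) (keyStep (l, 4) (x, k)) = (x, k)
    have h1 : keyStep (l, 4) (x, k) = (x - uvec l + uvec k, l) := if_neg hl
    have h2 : keyStep (k, 4) (x - uvec l + uvec k, l) = (x - uvec l + uvec k - uvec k + uvec l, k) :=
      if_neg (Ne.symm hl)
    rw [h1, h2]
    refine Prod.ext ?_ rfl
    simp only
    abel
  · exact ⟨(l, 2), by simp [keyStep, hl]⟩

/-- Adjacent keys are equal or one move apart. [cite: FriedliVelenik2017, Lemma 3.38 and Exercise 5.10] -/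
theorem exists_keyStep_of_adj {e e' : Key d} (h : Adj e e') : e' = e ∨ ∃ μ, keyStep μ e = e' := by
  obtain ⟨x, k⟩ := e
  obtain ⟨l, hl, h | h⟩ := adj_iff.1 h
  · simp only at hl h
    rcases mem_plaqEdges.1 h with rfl | rfl | rfl | rfl
    · exact Or.inl rfl
    · exact Or.inr ⟨(l, 0), by simp [keyStep, hl]⟩
    · exact Or.inr ⟨(l, 1), by simp [keyStep, hl]⟩
    · exact Or.inr ⟨(l, 2), by simp [keyStep, hl]⟩
  · simp only at hl h
    rcases mem_plaqEdges.1 h with rfl | rfl | rfl | rfl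
    · exact Or.inr ⟨(l, 5), by simp [keyStep, hl]⟩
    · exact Or.inr ⟨(l, 3), by simp [keyStep, hl]⟩
    · exact Or.inr ⟨(l, 4), by simp [keyStep, hl]⟩
    · left; simp

/-- The keys adjacent to `e` are among `e` and its move images. [folklore] -/
private theorem filter_adj_subset (e : Key d) (S : Finset (Key d)) :
    S.filter (Adj e) ⊆ insert e ((univ : Finset (Fin d × Fin 6)).image fun μ => keyStep μ e) := by
  intro e' he'
  rcases exists_keyStep_of_adj (mem_filter.1 he').2 with rfl | ⟨μ, hμ⟩
  · exact mem_insert_self _ _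
  · exact mem_insert_of_mem (mem_image.2 ⟨μ, mem_univ _, hμ⟩)

/-- At most `6d + 1` keys are adjacent to a given key (the entropy constant of the Kotecký–Preiss verification). [cite: FriedliVelenik2017, Lemma 3.38 and Exercise 5.10] -/
theorem card_filter_adj_le (e : Key d) (S : Finset (Key d)) : (S.filter (Adj e)).card ≤ 6 * d + 1 := by
  refine (card_le_card (filter_adj_subset e S)).trans ((card_insert_le _ _).trans ?_)
  have := card_image_le (s := (univ : Finset (Fin d × Fin 6))) (f := fun μ => keyStep μ e)
  simp only [card_univ, Fintype.card_prod, Fintype.card_fin] at this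
  omega

/-- A connected edge set is step-connected (for the move system `keyStep`) from each of its points.
[cite: FriedliVelenik2017, Lemma 3.38] -/
theorem isStepConnected_of_isConn {γ : Finset (Key d)} (hγ : IsConn γ) {e : Key d} (he : e ∈ γ) :
    Combinatorics.Enumerative.IsStepConnected keyStep γ e := by
  refine ⟨he, fun b hb => ?_⟩
  have h := hγ e he b hb
  induction h with
  | refl => exact Relation.ReflTransGen.refl
  | @tail x y _ hs ih =>
    rcases exists_keyStep_of_adj hs.2 with rfl | ⟨μ, hμ⟩
    · exact ih hs.1
    · exact Relation.ReflTransGen.tail (ih ((Linked.mem_of_mem ‹_› he))) ⟨hs.1, μ, hμ⟩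

/-- **Contour counting** (F–V Lemma 3.38 ∕ (5.27)): at most `(6d+1)^{2(n-1)}` contours with `n` edges
pass through a given edge. [cite: FriedliVelenik2017, Lemma 3.38 and Exercise 5.10] -/
theorem card_le_of_contours_through (e : Key d) (n : ℕ) (𝒮 : Finset (Finset (Key d)))
    (h𝒮 : ∀ γ ∈ 𝒮, IsConn γ ∧ e ∈ γ ∧ γ.card = n) : 𝒮.card ≤ (6 * d + 1) ^ (2 * (n - 1)) := by
  have h := Combinatorics.Enumerative.card_le_pow_of_stepConnected keyStep keyStep_inv e n 𝒮
    fun γ hγ => ⟨(h𝒮 γ hγ).2.2, isStepConnected_of_isConn (h𝒮 γ hγ).1 (h𝒮 γ hγ).2.1⟩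
  simpa [Fintype.card_prod, Fintype.card_fin, mul_comm] using h

/-! ### Geometry of contours needed for the cluster-expansion bounds -/

/-- Every finite edge set lies in some `ℰ^b_{B(L)}`. [cite: FriedliVelenik2017, §3.1 (ℤ^d: nearest neighbours x, x + e_k; ℰ_Λ^b)] -/
theorem exists_subset_boxKeys (E : Finset (Key d)) : ∃ L : ℕ, E ⊆ boxKeys L := by
  refine ⟨E.sup fun e => univ.sup fun i => (e.1 i).natAbs, fun e he => mem_boxKeys.2 (Or.inl ?_)⟩
  rw [mem_box]; intro i
  have h1 : (e.1 i).natAbs ≤ univ.sup fun j => (e.1 j).natAbs :=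
    Finset.le_sup (f := fun j => (e.1 j).natAbs) (mem_univ i)
  have h2 : (univ.sup fun j => (e.1 j).natAbs) ≤ E.sup fun e : Key d => univ.sup fun j => (e.1 j).natAbs :=
    Finset.le_sup (f := fun e : Key d => univ.sup fun j => (e.1 j).natAbs) he
  omega

/-- Adjacent keys have base points at sup-distance at most one. [folklore] -/
private theorem abs_sub_le_one_of_adj {e e' : Key d} (h : Adj e e') (m : Fin d) : |e.1 m - e'.1 m| ≤ 1 := by
  obtain ⟨y, k, l, -, he, he'⟩ := h
  have key : ∀ f ∈ plaqEdges y k l, f.1 m = y m ∨ f.1 m = y m + 1 := by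
    intro f hf
    rcases mem_plaqEdges.1 hf with rfl | rfl | rfl | rfl
    · simp
    · simp
    · dsimp only; rw [add_uvec_apply]; split_ifs <;> simp
    · dsimp only; rw [add_uvec_apply]; split_ifs <;> simp
  rcases key e he with h1 | h1 <;> rcases key e' he' with h2 | h2 <;> rw [h1, h2, abs_le] <;> constructor <;> linarith

/-- Discrete intermediate values along a chain of adjacent keys. [folklore] -/
private theorem exists_mem_apply_eq_of_linked {E : Finset (Key d)} {a b : Key d} (h : Linked E a b) (ha : a ∈ E)
    (m : Fin d) {v : ℤ} (hv1 : min (a.1 m) (b.1 m) ≤ v) (hv2 : v ≤ max (a.1 m) (b.1 m)) :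
    ∃ c ∈ E, c.1 m = v := by
  induction h with
  | refl => exact ⟨a, ha, le_antisymm (by simpa using hv1) (by simpa using hv2)⟩
  | @tail x y hx hs ih =>
    by_cases hvx : min (a.1 m) (x.1 m) ≤ v ∧ v ≤ max (a.1 m) (x.1 m)
    · exact ih hvx.1 hvx.2
    · have h1 := abs_sub_le_one_of_adj hs.2 m
      rw [abs_le] at h1
      refine ⟨y, hs.1, ?_⟩
      rw [not_and_or, not_le, not_le] at hvx
      rcases hvx with hvx | hvx
      · have := min_le_left (a.1 m) (x.1 m); have := min_le_right (a.1 m) (x.1 m)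
        have := le_max_left (a.1 m) (y.1 m); have := le_max_right (a.1 m) (y.1 m)
        rcases le_total (a.1 m) (x.1 m) with h | h
        · rw [min_eq_left h] at hvx
          rw [min_le_iff] at hv1
          rcases hv1 with hv1 | hv1
          · omega
          · rw [le_max_iff] at hv2; omega
        · rw [min_eq_right h] at hvx
          rw [min_le_iff] at hv1; rw [le_max_iff] at hv2; omega
      · rcases le_total (a.1 m) (x.1 m) with h | h
        · rw [max_eq_right h] at hvx
          rw [min_le_iff] at hv1; rw [le_max_iff] at hv2; omega
        · rw [max_eq_left h] at hvx
          rw [min_le_iff] at hv1; rw [le_max_iff] at hv2; omega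

/-- A connected edge set containing keys whose `m`-coordinates differ by `n` has at least `n + 1` edges. [cite: FriedliVelenik2017, Thm. 5.16, proof p. 261 (each X ∈ 𝒞_{i,j} has |X̄| ≥ ‖j-i‖)] -/
theorem card_ge_of_isConn {E : Finset (Key d)} (hE : IsConn E) {a b : Key d} (ha : a ∈ E) (hb : b ∈ E)
    (m : Fin d) : (b.1 m - a.1 m).natAbs + 1 ≤ E.card := by
  have hsub : Finset.Icc (min (a.1 m) (b.1 m)) (max (a.1 m) (b.1 m)) ⊆ E.image fun c : Key d => c.1 m := by
    intro v hv
    rw [Finset.mem_Icc] at hv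
    obtain ⟨c, hc, hcv⟩ := exists_mem_apply_eq_of_linked (hE a ha b hb) ha m hv.1 hv.2
    exact mem_image.2 ⟨c, hc, hcv⟩
  have h1 := card_le_card hsub
  rw [Int.card_Icc] at h1
  have h2 := card_image_le (s := E) (f := fun c : Key d => c.1 m)
  have : (max (a.1 m) (b.1 m) + 1 - min (a.1 m) (b.1 m)).toNat = (b.1 m - a.1 m).natAbs + 1 := by
    rcases le_total (a.1 m) (b.1 m) with h | h
    · rw [max_eq_right h, min_eq_left h]; omega
    · rw [max_eq_left h, min_eq_right h]; omega
  omega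

/-- The union of an `inc`-cluster of connected edge sets is connected. [cite: KoteckyPreiss1986, §2 (clusters)] -/
theorem isConn_biUnion_of_isPolymerCluster {C : Finset (Finset (Key d))} (hC : IsPolymerCluster ContourInc C)
    (hconn : ∀ γ ∈ C, IsConn γ) : IsConn (C.biUnion id) := by
  classical
  intro a ha b hb
  set U := C.biUnion id with hU
  obtain ⟨γa, hγa, haγ⟩ := mem_biUnion.1 ha
  -- the members reached from `a`
  set C₁ := C.filter fun γ => ∃ c ∈ γ, Linked U a c with hC₁
  have hC₁all : C₁ = C := by
    by_contra hne
    have hsub : C₁ ⊆ C := filter_subset _ _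
    have hne1 : C₁.Nonempty := ⟨γa, mem_filter.2 ⟨hγa, a, haγ, linked_refl U a⟩⟩
    have hne2 : (C \ C₁).Nonempty := by
      rw [Finset.sdiff_nonempty]; exact fun h => hne (subset_antisymm hsub h)
    obtain ⟨γ₁, hγ₁, γ₂, hγ₂, hinc⟩ := hC C₁ hsub hne1 hne2
    obtain ⟨hγ₂C, hγ₂not⟩ := mem_sdiff.1 hγ₂
    obtain ⟨hγ₁C, c, hcγ₁, hac⟩ := mem_filter.1 hγ₁
    rcases hinc with rfl | ⟨x, hx, y, hy, hxy⟩
    · exact hγ₂not hγ₁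
    · refine hγ₂not (mem_filter.2 ⟨hγ₂C, y, hy, ?_⟩)
      have hγ₁U : γ₁ ⊆ U := fun z hz => mem_biUnion.2 ⟨γ₁, hγ₁C, hz⟩
      have hcx : Linked U c x := ((hconn γ₁ hγ₁C) c hcγ₁ x hx).mono hγ₁U
      exact (hac.trans hcx).tail ⟨mem_biUnion.2 ⟨γ₂, hγ₂C, hy⟩, hxy⟩
  obtain ⟨γb, hγb, hbγ⟩ := mem_biUnion.1 hb
  have hγb1 : γb ∈ C₁ := hC₁all ▸ hγb
  obtain ⟨-, c, hcγb, hac⟩ := mem_filter.1 hγb1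
  have hγbU : γb ⊆ U := fun z hz => mem_biUnion.2 ⟨γb, hγb, hz⟩
  exact hac.trans (((hconn γb hγb) c hcγb b hbγ).mono hγbU)

section Surround

variable [NeZero d]

/-- A contour surrounding `i` crosses the ray above `i`: some `(i + t e₀, 0) ∈ γ`. [cite: FriedliVelenik2017, §5.7.4 (i ∈ Int γ)] -/
theorem exists_mem_ray_of_par_ne_zero {γ : Finset (Key d)} {i : Site d} (h : par γ i ≠ 0) :
    ∃ t : ℕ, (i + t • uvec 0, (0 : Fin d)) ∈ γ := by
  have hne : (rayKeys γ i).Nonempty := by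
    rw [← card_pos]; unfold par rayCount at h; by_contra h0; push Not at h0
    exact h (by rw [Nat.le_zero.1 h0, Nat.cast_zero])
  obtain ⟨e, he⟩ := hne
  obtain ⟨heγ, h2, h0, hrest⟩ := by simpa [rayKeys] using he
  refine ⟨(e.1 0 - i 0).toNat, ?_⟩
  have hx : i + (e.1 0 - i 0).toNat • uvec 0 = e.1 := by
    funext j
    rw [add_nsmul_uvec_apply]
    by_cases hj : j = 0
    · subst hj; rw [if_pos rfl, Int.toNat_of_nonneg (by omega)]; ring
    · rw [if_neg hj, add_zero, hrest j hj]
  rw [hx, ← h2]; exact heγ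

/-- A `ZMod 2`-valued sequence with different end values changes value at some step. [folklore] -/
private theorem exists_step_ne {f : ℕ → ZMod 2} {S : ℕ} (h : f 0 ≠ f S) : ∃ s < S, f s ≠ f (s + 1) := by
  induction S with
  | zero => exact absurd rfl h
  | succ S ih =>
    by_cases hS : f 0 = f S
    · exact ⟨S, Nat.lt_succ_self S, hS ▸ h⟩
    · obtain ⟨s, hs, hne⟩ := ih hS; exact ⟨s, Nat.lt_succ_of_lt hs, hne⟩

/-- **A closed edge set surrounding `i` crosses every axis ray from `i`** (`d ≥ 2`): in each direction `m`
it has an edge `(y, m)` with `y_m ≥ i_m` and one with `y_m < i_m`. [cite: FriedliVelenik2017, §5.7.4 (Int γ; every path from Int γ to Λ^c crosses γ)] -/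
theorem exists_mem_dir_of_par_ne_zero (hd : 2 ≤ d) {γ : Finset (Key d)} (hγ : IsClosedKeys γ) {i : Site d}
    (h : par γ i ≠ 0) (m : Fin d) :
    (∃ y : Site d, (y, m) ∈ γ ∧ i m ≤ y m) ∧ (∃ y : Site d, (y, m) ∈ γ ∧ y m < i m) := by
  obtain ⟨L, hL⟩ := exists_subset_boxKeys γ
  -- far along `±e_m` the parity vanishes
  obtain ⟨S, hS⟩ : ∃ S : ℕ, (L : ℤ) < i m + S ∧ i m - S < -(L : ℤ) := by
    have h1 := Int.self_le_toNat ((L : ℤ) + |i m| + 1)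
    have h2 := le_abs_self (i m)
    have h3 := neg_abs_le (i m)
    exact ⟨((L : ℤ) + |i m| + 1).toNat, by omega, by omega⟩
  have hfar : ∀ y : Site d, ((L : ℤ) < y m ∨ y m < -(L : ℤ)) → par γ y = 0 := fun y hy =>
    par_eq_zero_of_not_mem_box hd hγ hL fun hb => by have := (mem_box.1 hb) m; omega
  constructor
  · have h0S : par γ (i + 0 • uvec m) ≠ par γ (i + S • uvec m) := by
      have hfarS : par γ (i + S • uvec m) = 0 :=
        hfar (i + S • uvec m) (Or.inl (by rw [add_nsmul_uvec_apply, if_pos rfl]; exact hS.1))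
      rw [zero_nsmul, add_zero, hfarS]
      exact h
    obtain ⟨s, -, hs⟩ := exists_step_ne (f := fun s => par γ (i + s • uvec m)) h0S
    refine ⟨i + s • uvec m, ?_, by rw [add_nsmul_uvec_apply, if_pos rfl]; omega⟩
    have key := par_add_par_tip hγ (i + s • uvec m, m)
    simp only at key
    rw [show i + s • uvec m + uvec m = i + (s + 1) • uvec m by rw [succ_nsmul, add_assoc]] at key
    by_contra hmem
    rw [ind_of_not_mem hmem] at key
    have : ∀ a b : ZMod 2, a + b = 0 → a = b := by decide
    exact hs (this _ _ key)
  · have h0S : par γ (i - 0 • uvec m) ≠ par γ (i - S • uvec m) := by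
      have hfarS : par γ (i - S • uvec m) = 0 :=
        hfar (i - S • uvec m) (Or.inr (by rw [sub_nsmul_uvec_apply, if_pos rfl]; exact hS.2))
      rw [zero_nsmul, sub_zero, hfarS]
      exact h
    obtain ⟨s, -, hs⟩ := exists_step_ne (f := fun s => par γ (i - s • uvec m)) h0S
    refine ⟨i - (s + 1) • uvec m, ?_, ?_⟩
    · have key := par_add_par_tip hγ (i - (s + 1) • uvec m, m)
      simp only at key
      rw [show i - (s + 1) • uvec m + uvec m = i - s • uvec m by rw [succ_nsmul]; abel] at key
      by_contra hmem
      rw [ind_of_not_mem hmem] at key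
      have : ∀ a b : ZMod 2, a + b = 0 → b = a := by decide
      exact hs (this _ _ key)
    · rw [sub_nsmul_uvec_apply, if_pos rfl]; push_cast; omega

/-- **The whole line through `i` crosses a closed set an even number of times** (`d ≥ 2`): if the ray
above `i` meets `γ` (parity odd) then so does the ray below, i.e. `γ` has an edge `(y, 0)` on the line
with `y₀ < i₀`; together with an edge at height `≥ i₀ + t` this forces `|γ| ≥ t + 2` when `γ` is
connected. [cite: FriedliVelenik2017, §5.7.4 (contours are closed surfaces)] -/
theorem card_ge_of_surround (hd : 2 ≤ d) {γ : Finset (Key d)} (hγc : IsClosedKeys γ) (hγn : IsConn γ)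
    {i : Site d} (h : par γ i ≠ 0) {t : ℕ} (ht : (i + t • uvec 0, (0 : Fin d)) ∈ γ) : t + 2 ≤ γ.card := by
  obtain ⟨-, y, hy, hlt⟩ := exists_mem_dir_of_par_ne_zero hd hγc h 0
  have := card_ge_of_isConn hγn hy ht 0
  simp only [add_nsmul_uvec_apply, if_true] at this
  omega

end Surround

end LTContour

end Literature.Probability.LatticeModels
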